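import Literature.AlgebraicGeometry.Deformation.CurvilinearSmoothness
import Literature.AlgebraicGeometry.Deformation.T1LiftingAuxiliaryAlgebras
import Mathlib.RingTheory.MvPowerSeries.Rename
import HarnessLib

/-!
# T¹-lifting and curvilinear liftings over a formal power series base `Λ = k[[t_1, …, t_m]]`:
# [KN94, Thm. 3.1] for pro-representable functors in abstract form, the relative [FM98, Lemma 5.6] behind its
# «hence the hull `R` of `LD` is formally smooth over `Λ_m`», [Sch68, Prop. 2.5 (i)] at `R = Λ` and [Sch68, Remark 2.10]
# over `Λ` — AS PRINTED around them, with the one statement print does not isolate (the relative Lemma 5.6) PROVED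

Family `hodge` (computation cell `pub-hsemireg`, LIT-W seat «Kawamata ∕ Ran T¹-lifting as printed»), layer
`Literature/AlgebraicGeometry/Deformation`, on top of `CurvilinearSmoothness.lean` (the absolute [FM98, Lemma 5.6])
and `T1LiftingAuxiliaryAlgebras.lean` (the obstruction-space formalism `ArtinFunctor.ObstructionSpace`, `kerMap`).
THEOREMS only (no definition, no named fact, no `sorry`); everything is stated on the carriers of `T1Lifting.lean`
(`ArtAlg k`; the algebras `A_N = k[t]/(t^{N+1})`, `B_N = A_N[ε]`, `C_N = B_N/(x^N y)` of [FantechiManetti1999T1Lifting,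
Def. 1.1 / p. 3] = `T1Lifting.A/B/C k N` with their maps `i`, `j`, `β`, `bA`, `fB`, `fC`, `gC`, `jB` and the two
cartesian squares `T1Lifting.isCartesian_gC_jB`, `T1Lifting.isCartesian_fB_i`) and on Mathlib's `MvPowerSeries.rename`
(renaming of variables along a map with finite fibres). A functor on `Art_Λ` is handled as the functor of points `h_R`
on `Art_k` TOGETHER WITH the `Λ`-structures: a «`Λ`-algebra structure on `A`» ([KawamataNamikawa1994LogDeformations,
p. 401]) is a `k`-algebra map `Λ → A`, and `h_R → h_Λ` is composition with `Λ → R`.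

## Sources, verbatim

* [KawamataNamikawa1994LogDeformations] (Invent. Math. 118; read by eye on the GDZ page images, pp. 401–402), §3
  «T¹-lifting property», p. 401: «Let `A_k = ℂ[t]/(t^{k+1})` and `A_k[ε] = ℂ[t, ε]/(t^{k+1}, ε)` [sic; `ε²`] for `k ≥ −1`.
  … Set `Λ_m = ℂ[[t_1, …, t_m]]` as before. Let `𝒜_k` and `𝒜_k[ε]` be `Λ_m`-algebras whose underlying `ℂ`-algebras
  are `A_k` and `A_k[ε]`, respectively. … We always assume that the images of the `t_i` are in the maximal ideals for
  `k ≥ 0`, and the natural homomorphisms `𝒜_k → 𝒜_{k−1}`, `𝒜_k[ε] → 𝒜_{k−1}[ε]` and `𝒜_k[ε] → 𝒜_k` are over `Λ_m` for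
  all `k`. Then `LD` is said to have the T¹-lifting property if the natural maps
  `LD(𝒜_k[ε]) → LD(𝒜_k) ×_{LD(𝒜_{k−1})} LD(𝒜_{k−1}[ε])` are surjective for all `k ≥ 0` and all `Λ_m`-algebra structures
  on the `A_k`, etc. as above.»; «THEOREM 3.1. Let `(X, 𝒰₀)` be a n.c. variety, `m` the number of connected components
  of Sing `X`, and `LD` its logarithmic deformation functor. Assume that `LD` is pro-representable and has the
  T¹-lifting property. Then `LD` is unobstructed, i.e., its hull `R` is formally smooth over `Λ_m`.»; proof, p. 401–402:
  «We fix a `Λ_m`-algebra structure `𝒜_{k+1}` on `A_{k+1}` for some `k ≥ 0`. … we have the following commutative diagram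
  of obstruction sequences: `LD(𝒜_{k+1}) → LD(𝒜_k) →^{δ₁} (t^{k+1}) ⊗ H²(X, T_{X/ℂ}(log))` … By the T¹-lifting property,
  we have `δ₂ = 0`. Since `α″` is an isomorphism, we also have `δ₁ = 0`, hence the hull `R` of `LD` is formally smooth
  over `Λ_m`. Q.E.D.» — so the printed proof ends with: `LD(𝒜_{k+1}) → LD(𝒜_k)` is onto FOR EVERY `Λ_m`-ALGEBRA
  STRUCTURE `𝒜_{k+1}` on `A_{k+1}` and every `k ≥ 0`, HENCE (for the pro-representable `LD ≅ h_R` on `Art_{Λ_m}`) `R` is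
  formally smooth over `Λ_m`. That «hence» — relative curvilinear surjectivity over a formal power series base implies
  formal smoothness over it — is the central theorem of this file; the step before it («T¹-lifting ⇒ `δ₁ = 0`») is
  typed through the cartesian squares of [FantechiManetti1999T1Lifting, p. 3] rather than through the obstruction
  spaces of `LD` (p. 396: «Here the base field should be of characteristic zero.»).
* [FantechiManetti1999T1Lifting] (J. Algebraic Geom. 8; authors' version p. 3, l. 13–25): «the T¹-lifting condition can
  be rephrased by saying that, given a `c ∈ F(C_n)`, there exists `b ∈ F(B_n)` having the same projections to `B_{n−1}`
  and `A_n`. If `F` satisfies (H4), then the T¹-lifting condition becomes that `F(B_n) → F(C_n)` is onto for every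
  `n ∈ ℕ`. The cartesian diagram (in characteristic zero) [`A_{m+1} → A_m`, `A_{m+1} → B_m`, `A_m → C_m`, `B_m → C_m`]
  together with condition (H1) immediately implies that `j : F(A_{m+1}) → F(A_m)` is surjective and the theorem; in
  fact, this is essentially Kawamata's proof.» (tree, absolute: `ArtinFunctor.map_j_succ_surjective_of_t1Lifting`,
  `ArtinFunctor.map_i_surjective_of_map_j_surjective`).
* [FantechiManetti1998ObstructionCalculus] (J. Algebra 202, store text pp. 561–562), LEMMA 5.6: «Let `R ∈ Ârt_k`.
  Then the following are equivalent: (i) the functor `h_R` is smooth (hence `R` is a power series algebra); (ii) `h_R`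
  has no curvilinear obstructions; (iii) there exists `N₀ ∈ ℕ` such that the map `h_R(k[t]/t^{N+1}) → h_R(k[t]/t^N)` is
  surjective for `N ≥ N₀`.» («The only nontrivial implication is (iii) ⇒ (i). Write `R = P/I`, with
  `P = k[[x_1, …, x_n]]` and `I ⊂ 𝔪_P²`. Assume `I ≠ 0` …» — weights `a_i`, the curve `x_i ↦ t^{A_i}`, «`c(I) ⊂ (t^B)` …
  As `c(I)` is not contained in `(t^{B+1})`, `f` does not lift to `h_R(k[[t]]/t^{B+1})`, contradicting (iii)»; the
  tree's `powerSeries_ideal_eq_bot_of_points_map_i_surjective`). REMARK, p. 562 (after Example 5.7): «The above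
  examples show that a morphism in Gdt without relative curvilinear obstructions is not necessarily smooth, even in the
  prorepresentable case and algebraically closed ground field. Therefore the above Lemma 5.6 does not generalize to
  the relative case; the best result we can prove is the following: PROPOSITION 5.8. Let `k` be an algebraically
  closed field, and let `S → R` be a morphism in `Ârt_k`. Assume that `h_R → h_S` has no relative curvilinear
  obstructions. Then `S_red → R_red` is smooth, and `dim R − dim S = dim t_R − dim t_S`.» and p. 562: «Note also that if
  `k` is not algebraically closed then Proposition 5.8 may fail, cf. Example 5.7(iii).» The two printed
  counterexamples — EXAMPLE 5.7 (ii): «Let `R = k[x, y]/(x³, y³, x²y²)`, and let `S = k[x, y]/(x³, y³)`. Then the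
  morphism `h_R → h_S` has no relative curvilinear obstructions.» (tree: `RelativeCurvilinearLiftingNotSmooth.lean`) and
  (iii): «Let `k = ℝ`, `R = k[[x, y]]/(x² + y²)`, `S = k[[x, y]]/(x², y²)` … Then the morphism `h_S → h_R` has no
  curvilinear obstructions.» (tree: `RelativeCurvilinearLiftingNonClosedField.lean`) — are both over a base (`S`,
  resp. `R`) that is NOT a formal power series ring. (Def. 3.5, p. 552: relative curvilinear obstructions of a
  morphism `ν : F → G` = obstructions along the curvilinear extensions `0 → k → k[t]/t^{n+1} → k[t]/tⁿ → 0` to lifting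
  in `F(A_{n}) ×_{G(A_n)} G(A_{n+1})`; for `h_R → h_S` their vanishing is the lifting property used below, as in the two
  tree files.)
* [Schlessinger1968] (Trans. AMS 130), Prop. 2.5 (i), p. 211: «Let `R → S` be a morphism in `Ĉ`. Then `h_S → h_R` is
  smooth if and only if `S` is a power series ring over `R`.» with Def. 2.2, p. 210: «A morphism `F → G` of functors is
  smooth if for any surjection `B → A` in `C`, the morphism `F(B) → F(A) ×_{G(A)} G(B)` is surjective.» (tree, `R = k`:
  `powerSeries_ideal_eq_bot_iff_points_smooth`); (2.4), p. 211: «If `F → G` is smooth, then `F̂ → Ĝ` is surjective, in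
  the sense that `F̂(A) → Ĝ(A)` is surjective for all `A` in `Ĉ`»; REMARK 2.10, p. 212: «Let `(R, ξ)` be a hull of `F`.
  Then `R` is a power series ring over `Λ` if and only if `F` transforms surjections `B → A` in `C` into surjections
  `F(B) → F(A)`. In fact the stated condition on `F` is equivalent to the smoothness of the natural morphism `F → h_Λ`.
  … we conclude that `h_R → h_Λ` is smooth if and only if `F → h_Λ` is. Now use 2.5 (i).» (`C = C_Λ`; tree, `Λ = k`:
  `ArtinFunctor.hull_ideal_eq_bot_iff_smooth` in `T1LiftingTheoremSmoothness.lean`).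

## What this file proves

SETTING. `k` any field; `P = k[[x_1, …, x_p]]` (`MvPowerSeries (Fin p) k`); an embedding `e : Fin m ↪ Fin p` singles
out the BASE variables `x_{e 1}, …, x_{e m}`, so that `Λ = k[[t_1, …, t_m]] → P`, `t_j ↦ x_{e j}`, is
`MvPowerSeries.rename e` and `P = Λ[[x_v : v ∉ range e]]`; an ideal `I ⊆ 𝔪_Λ P + 𝔪_P²`
(`Ideal.span (range (X ∘ e)) ⊔ (maximalIdeal P)²` — the relative reading of «`I ⊂ 𝔪_P²`»: no fibre variable is
redundant); `R = P/I` with the `Λ`-structure `Λ → P → R`. A «`Λ`-algebra structure on `A_{N+1}`» is a `k`-algebra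
map `b : Λ → A_{N+1}` (equivalently the family of images of the `t_j`, automatically in the maximal ideal:
`T1Lifting.exists_algHom_of_pow_eq_bot`, `T1Lifting.mvPowerSeries_algHom_ext`, `T1Lifting.algHom_X_mem_maximalIdeal`).
* `mvPowerSeries_relativeLifting_rename` — [Sch68, Prop. 2.5 (i)] «if»: `h_P → h_Λ` lifts along every surjection of
  `Art_k` (compatible `a : P → R₂`, `b : Λ → R₁` over `φ : R₁ ↠ R₂` have `a' : P → R₁` with `φ ∘ a' = a`, `a'|_Λ = b`);
  `relativeLifting_quotient_of_eq_bot` — the same for `P/I` when `I = 0`.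
* `powerSeries_ideal_eq_bot_of_relativeCurvilinearLifting` — THE RELATIVE LEMMA 5.6 (iii) ⇒ (i) OVER `Λ`: if for some
  `N₀` and every `N ≥ N₀`, every `a : R → A_N` and every `Λ`-structure `b : Λ → A_{N+1}` compatible with `a`
  (`i_N ∘ b = a|_Λ`) there is a lift `a' : R → A_{N+1}` of `a` with `a'|_Λ = b`, then `I = 0`. PROOF = the printed weight
  argument of [FM98, p. 561] on all the variables of `P` (`T1Lifting.exists_weights`, `T1Lifting.exists_curve` on `P`
  AND on `Λ`, `T1Lifting.prod_pow_eq_of_sub_mem`, `T1Lifting.algHom_eq_zero_of_coeff_eq_zero`), the `Λ`-structure of the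
  test algebra `A_{N+1}` being PRESCRIBED as the weighted curve on the base variables: a lift then agrees with the curve
  exactly on the base variables and to first order on the fibre variables, which is all a monomial of `𝔪_Λ P + 𝔪_P²`
  sees (`T1Lifting.two_le_degree_or_eq_single_of_coeff_ne_zero`: such monomials have degree `≥ 2` or are a bare `t_j`).
* `powerSeries_ideal_eq_bot_iff_relativeCurvilinearLifting` — (i) ⟺ (iii) relative; and
  `powerSeries_ideal_eq_bot_iff_relativelySmooth` — [Sch68, Prop. 2.5 (i)] at `R = Λ` for presented `S = P/I`:
  `I = 0` iff `h_{P/I} → h_Λ` is smooth in the sense of Def. 2.2.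
* `powerSeries_ideal_eq_bot_of_forall_structures_lifting` — the criterion in [KN94, p. 401]'s wording («all
  `Λ_m`-algebra structures on the `A_k`»: families `σ_j ∈ A_{N+1}` of images of the `t_j`).
* `exists_retraction_of_relativeCurvilinearLifting` — consequence by hand: then `R` retracts onto `Λ` (a `k`-algebra
  section `R → Λ` of `Λ → R`; `MvPowerSeries.killCompl e`).
* THE FIRST HALF OF THE PROOF OF [KN94, Thm. 3.1], for ANY functor of Artin rings `F` with (H₄) over `h_{Λ'}`
  (`ν : F → h_{Λ'}` natural; `Λ'` any `k`-algebra): `ArtinFunctor.relative_map_j_succ_surjective_of_relativeT1Lifting`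
  (relative T¹-lifting in the printed fibre-product form at `n` ⇒ the relative `C`-form at `n + 1`),
  `ArtinFunctor.relative_map_i_surjective_of_relative_map_j_surjective` (`char k = 0`: relative `C`-form at `m` ⇒
  liftings `F(𝒜_{m+1}) ↠ F(𝒜_m)` for every `Λ'`-structure `𝒜_{m+1}` — Kawamata's argument one index at a time,
  relative: [KN94]'s «we also have `δ₁ = 0`» for (H₄)-functors), the easy converse
  `ArtinFunctor.relativeT1Lifting_of_relativeLifting`; and their instances for `h_R → h_{Λ'}` with `R`, `Λ'` ANY
  `k`-algebras, `σ : Λ' → R` (`relative_map_j_succ_surjective_of_relativeT1Lifting`,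
  `relative_map_i_surjective_of_relative_map_j_surjective`, `relativeT1Lifting_of_relativeLifting`).
* `powerSeries_ideal_eq_bot_of_relativeT1Lifting` — [KN94, THM. 3.1] FOR PRO-REPRESENTABLE FUNCTORS, ABSTRACT FORM
  (`char k = 0`, `R = P/I` presented over `Λ`): relative T¹-lifting for all `n` and all `Λ`-structures on `B_{n+1}` ⇒
  `I = 0`; and `powerSeries_ideal_eq_bot_iff_relativeT1Lifting` — the equivalence with the easy converse.
* `points_surjective_of_smooth_of_surjective_zero` ([Sch68, (2.4)]: a smooth `h_R → F` onto on `A_0`-points is onto on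
  all points) and `hull_ideal_eq_bot_iff_relativelySmooth` — [Sch68, REMARK 2.10] OVER `Λ` for a functor `F → h_Λ` WITH A
  GIVEN presented hull `h_{P/I} → F` compatible with the `Λ`-structures: `I = 0` («`R` is a power series ring over `Λ`»)
  iff `F → h_Λ` is smooth — so [KN94]'s «`LD` is unobstructed, i.e., its hull `R` is formally smooth over `Λ_m`» has
  both readings available.
* `ArtinFunctor.map_i_surjective_of_map_j_surjective_of_obstructionSpace` — [KN94]'S OWN ROUTE FOR THE FIRST STEP,
  absolute form, through an OBSTRUCTION SPACE ([FM99, Def. 0.1], the tree's `ArtinFunctor.ObstructionSpace`; for `LD`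
  this is [KN94, Thm. 2.2 (3)]): along the morphism of small extensions `(α, α′) = (fB, fC) : (A_{m+1} → A_m) →
  (B_m → C_m)` the kernel map `α″ : t^{m+1} ↦ (m+1) x^m y` is injective in characteristic zero
  (`T1Lifting.kerMap_fB_injective`), so «`δ₂ = 0`» (`F(B_m) → F(C_m)` onto at `F(α′) a`) forces «`δ₁ = 0`» and
  `F(A_{m+1}) → F(A_m)` is onto — assuming the obstruction space and nothing of (H₁)/(H₂)/(H₄); for all levels at once
  `ArtinFunctor.map_i_surjective_of_t1LiftingH4_of_obstructionSpace`.

HONEST SCOPE. (1) The relative Lemma 5.6 over a formal power series base is NOT stated as a lemma in either source: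
[KN94] USE the inference («hence») for the hull of `LD` over `Λ_m = ℂ[[t_1, …, t_m]]`, with no argument; [FM98] print
that Lemma 5.6 «does not generalize to the relative case» (base `S ∈ Ârt_k` arbitrary) and prove Prop. 5.8 instead
(`k = k̄`, conclusion on `S_red → R_red`). What is proved here is exactly the case in which the printed proof of Lemma 5.6
goes through word for word — base a FORMAL POWER SERIES RING, test algebras `A_{N+1}` with EVERY `Λ`-structure — for
every field `k`; it does not contradict the Remark (whose counterexamples have non-regular bases) and it does not
reprove Prop. 5.8. (2) `R` is PRESENTED as `P/I` with the base variables among the `x`'s and `I ⊆ 𝔪_Λ P + 𝔪_P²`;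
that every complete local Noetherian `Λ`-algebra with residue field `k` is of this form (Cohen, with `p − m` the
relative embedding dimension) is not formalised, as in `CurvilinearSmoothness.lean`. (3) Neither `LD`, nor a normal
crossing variety, nor [KN94]'s obstruction theory (Thm. 2.2 (3)) is instantiated: Thm. 3.1 is typed for an abstract
pro-representable functor on `Art_Λ` given as `h_{P/I} → h_Λ` (its first step for any (H₄)-functor over `h_{Λ'}`), and
that first step («T¹-lifting ⇒ `δ₂ = 0` ⇒ `δ₁ = 0`», printed with the diagram `α : t ↦ t + ε`, `α″ = (k+1)·`) is proved
in the RELATIVE setting by [FM99, p. 3]'s cartesian square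
`A_{m+1} = B_m ×_{C_m} A_m` («essentially Kawamata's proof»), which needs characteristic zero at the same point
(`(x + y)^{m+1} = (m+1) x^m y`, `T1Lifting.isCartesian_fB_i`), and in the ABSOLUTE setting also by the printed
obstruction-space route (`ArtinFunctor.map_i_surjective_of_map_j_surjective_of_obstructionSpace`; a RELATIVE
obstruction-space formalism — `ob` for `Λ`-functors — is not set up here); the printed hypothesis at `k = 0` is not
used (the relative Lemma 5.6 only needs the levels `N ≥ 1`). (4) Nothing here asserts that any geometric functor is smooth, has
a hull, or satisfies any lifting property.

## References

* Y. Kawamata, Y. Namikawa, *Logarithmic deformations of normal crossing varieties and smoothing of degenerate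
  Calabi–Yau varieties*, Invent. Math. 118 (1994) 395–409: p. 396, §3 p. 401, Thm. 3.1 and its proof pp. 401–402.
  [KawamataNamikawa1994LogDeformations]
* B. Fantechi, M. Manetti, *On the T¹-lifting theorem*, J. Algebraic Geom. 8 (1999) 31–39 (authors' version):
  Def. 1.1, p. 3 l. 13–25, Thm. A. [FantechiManetti1999T1Lifting]
* B. Fantechi, M. Manetti, *Obstruction calculus for functors of Artin rings, I*, J. Algebra 202 (1998) 541–576:
  Def. 3.5 (p. 552), Lemma 5.6 (p. 561), Example 5.7 (ii), (iii), Remark and Prop. 5.8 (p. 562).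
  [FantechiManetti1998ObstructionCalculus]
* M. Schlessinger, *Functors of Artin rings*, Trans. AMS 130 (1968) 208–222: Def. 2.2 (p. 210), (2.4) and
  Prop. 2.5 (i)–(iii) (p. 211), Remark 2.10 (p. 212). [Schlessinger1968]
-/

universe u

open MvPolynomial

namespace Literature.AlgebraicGeometry.Deformation

section RelativePowerSeries

namespace T1Lifting

variable (k : Type u) [Field k]

/-- An exponent of degree `≥ 2` dominates some `e_a + e_b`. [folklore] -/
private theorem exists_single_add_single_le_of_two_le {p : ℕ} (J : Fin p →₀ ℕ) (hJ : 2 ≤ J.degree) :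
    ∃ a b : Fin p, Finsupp.single a 1 + Finsupp.single b 1 ≤ J := by
  have hJ0 : J ≠ 0 := fun h => by simp [h] at hJ
  obtain ⟨a, ha⟩ : ∃ a, J a ≠ 0 := DFunLike.ne_iff.1 hJ0
  have haJ : Finsupp.single a 1 ≤ J := Finsupp.single_le_iff.2 (Nat.one_le_iff_ne_zero.2 ha)
  set J' := J - Finsupp.single a 1 with hJ'
  have hJJ' : J = Finsupp.single a 1 + J' := by rw [hJ', add_tsub_cancel_of_le haJ]
  have hJ'0 : J' ≠ 0 := by
    intro h
    rw [hJJ', h, add_zero, Finsupp.degree_single] at hJ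
    omega
  obtain ⟨b, hb⟩ : ∃ b, J' b ≠ 0 := DFunLike.ne_iff.1 hJ'0
  refine ⟨a, b, ?_⟩
  rw [hJJ']
  exact add_le_add le_rfl (Finsupp.single_le_iff.2 (Nat.one_le_iff_ne_zero.2 hb))

/-- An exponent of degree `< 2` is `0` or a single `e_v`. [folklore] -/
private theorem eq_zero_or_eq_single_of_degree_lt_two {p : ℕ} (J : Fin p →₀ ℕ) (hJ : J.degree < 2) :
    J = 0 ∨ ∃ v, J = Finsupp.single v 1 := by
  by_cases hJ0 : J = 0
  · exact Or.inl hJ0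
  obtain ⟨v, hv⟩ : ∃ v, J v ≠ 0 := DFunLike.ne_iff.1 hJ0
  have hle : Finsupp.single v 1 ≤ J := Finsupp.single_le_iff.2 (Nat.one_le_iff_ne_zero.2 hv)
  refine Or.inr ⟨v, ?_⟩
  obtain ⟨J', hJJ'⟩ : ∃ J', J = Finsupp.single v 1 + J' :=
    ⟨J - Finsupp.single v 1, (add_tsub_cancel_of_le hle).symm⟩
  have hdeg : J'.degree = 0 := by
    rw [hJJ', map_add, Finsupp.degree_single] at hJ
    omega
  rw [hJJ', (Finsupp.degree_eq_zero_iff J').1 hdeg, add_zero]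

/-- The degree of an exponent is bounded by any weight with weights `≥ 1`. [folklore] -/
private theorem degree_le_weight_of_one_le {p : ℕ} (a : Fin p → ℕ) (ha : ∀ i, 1 ≤ a i) (J : Fin p →₀ ℕ) :
    J.degree ≤ ∑ i, a i * J i := by
  rw [Finsupp.degree_eq_sum]
  exact Finset.sum_le_sum fun i _ => Nat.le_mul_of_pos_left _ (ha i)

/-- In an object of `Art_k` the maximal ideal is nilpotent: `𝔪_S^M = 0` for some `M ≥ 1`. [folklore] -/
private theorem exists_one_le_maximalIdeal_pow_eq_bot (S : ArtAlg.{u} k) :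
    ∃ M : ℕ, 1 ≤ M ∧ IsLocalRing.maximalIdeal S ^ M = ⊥ := by
  obtain ⟨M, hM⟩ := IsArtinianRing.isNilpotent_jacobson_bot (R := S)
  rw [IsLocalRing.jacobson_eq_maximalIdeal ⊥ bot_ne_top] at hM
  refine ⟨M + 1, Nat.le_add_left 1 M, le_bot_iff.1 ?_⟩
  calc IsLocalRing.maximalIdeal S ^ (M + 1) ≤ IsLocalRing.maximalIdeal S ^ M := Ideal.pow_le_pow_right (Nat.le_succ M)
    _ = ⊥ := hM

/-- THE SHAPE OF THE MONOMIALS OF `I ⊆ 𝔪_Λ P + 𝔪_P²` (`P = k[[x_1, …, x_p]]`, `Λ = k[[t_1, …, t_m]] ↪ P` along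
`t_j ↦ x_{e j}`, `𝔪_Λ P = (x_{e 1}, …, x_{e m})`): a monomial occurring in such an element is of degree `≥ 2` or is one
of the base variables `x_{e j}` — never a constant, never a bare fibre variable (the relative reading of
«`I ⊂ 𝔪_P²`», [FantechiManetti1998ObstructionCalculus, proof of Lemma 5.6]).
[cite: FantechiManetti1998ObstructionCalculus, Lemma 5.6] -/
theorem two_le_degree_or_eq_single_of_coeff_ne_zero {m p : ℕ} (e : Fin m ↪ Fin p)
    {g : MvPowerSeries (Fin p) k}
    (hg : g ∈ Ideal.span (Set.range fun j : Fin m => (MvPowerSeries.X (e j) : MvPowerSeries (Fin p) k)) ⊔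
      (IsLocalRing.maximalIdeal (MvPowerSeries (Fin p) k)) ^ 2)
    (J : Fin p →₀ ℕ) (hJ : MvPowerSeries.coeff J g ≠ 0) :
    2 ≤ J.degree ∨ ∃ j, J = Finsupp.single (e j) 1 := by
  classical
  by_contra hcon
  obtain ⟨hlt, hne⟩ := not_or.1 hcon
  have hlt' : J.degree < 2 := not_le.1 hlt
  have hne : ∀ j, J ≠ Finsupp.single (e j) 1 := fun j hj => hne ⟨j, hj⟩
  obtain ⟨s, hs, q, hq, rfl⟩ := Submodule.mem_sup.1 hg
  -- the `𝔪²` part has no monomial of degree `< 2`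
  have hq0 : MvPowerSeries.coeff J q = 0 := by
    refine MvPowerSeries.coeff_of_lt_order ?_
    exact lt_of_lt_of_le (by exact_mod_cast hlt') (two_le_order_of_mem_maximalIdeal_sq k hq)
  -- the `𝔪_Λ P` part is divisible by the `x_{e j}` termwise, and `J (e j) = 0` for every `j`
  have hJe : ∀ j, J (e j) = 0 := by
    intro j
    rcases eq_zero_or_eq_single_of_degree_lt_two J hlt' with h0 | ⟨v, hv⟩
    · rw [h0]
      rfl
    · rw [hv, Finsupp.single_apply]
      by_cases hvj : v = e j
      · exact absurd (hvj ▸ hv) (hne j)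
      · rw [if_neg hvj]
  have hs0 : MvPowerSeries.coeff J s = 0 := by
    obtain ⟨c, rfl⟩ := Ideal.mem_span_range_iff_exists_fun.1 hs
    rw [map_sum]
    refine Finset.sum_eq_zero fun j _ => ?_
    have hdvd : (MvPowerSeries.X (e j) : MvPowerSeries (Fin p) k) ∣ c j * MvPowerSeries.X (e j) :=
      dvd_mul_left _ _
    exact (MvPowerSeries.X_dvd_iff.1 hdvd) J (hJe j)
  exact hJ (by rw [map_add, hs0, hq0, add_zero])

/-- A special case recorded for use: such an `I` has no element with a nonzero constant term (`0 ∉ C` for the set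
`C` of exponents occurring in `I`, as `T1Lifting.exists_weights` requires).
[cite: FantechiManetti1998ObstructionCalculus, Lemma 5.6] -/
theorem coeff_zero_eq_zero_of_mem_sup {m p : ℕ} (e : Fin m ↪ Fin p) {g : MvPowerSeries (Fin p) k}
    (hg : g ∈ Ideal.span (Set.range fun j : Fin m => (MvPowerSeries.X (e j) : MvPowerSeries (Fin p) k)) ⊔
      (IsLocalRing.maximalIdeal (MvPowerSeries (Fin p) k)) ^ 2) :
    MvPowerSeries.coeff (0 : Fin p →₀ ℕ) g = 0 := by
  by_contra h
  rcases two_le_degree_or_eq_single_of_coeff_ne_zero k e hg 0 h with h2 | ⟨j, hj⟩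
  · simp at h2
  · have := congrArg (fun J : Fin p →₀ ℕ => J (e j)) hj
    simp at this

end T1Lifting

variable (k : Type u) [Field k]

/-- **LIFTING ALONG EVERY SURJECTION FOR THE POWER SERIES RING OVER THE BASE** — [Schlessinger1968, Prop. 2.5 (i),
p. 211]: «Let `R → S` be a morphism in `Ĉ`. Then `h_S → h_R` is smooth if and only if `S` is a power series ring over
`R`.» — its «if» half («Conversely, if `S` is a power series ring over `R`, then it is obvious that `h_S → h_R` is
smooth»), here for `R = Λ = k[[t_1, …, t_m]]` and `S = P = k[[x_1, …, x_p]] ⊇ Λ` along the renaming `t_j ↦ x_{e j}`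
(`MvPowerSeries.rename e`), smoothness in the form of [Schlessinger1968, Def. 2.2]: for every surjection
`φ : R₁ → R₂` of `Art_k`, every `a : P → R₂` and `b : Λ → R₁` with `φ ∘ b = a|_Λ` admit `a' : P → R₁` with
`φ ∘ a' = a` and `a'|_Λ = b` (keep `b` on the base variables, lift the images of the other variables inside the
maximal ideal, evaluate by `T1Lifting.exists_algHom_of_pow_eq_bot`, compare on variables by
`T1Lifting.mvPowerSeries_algHom_ext`). The absolute case `Λ = k` is the tree's `points_mvPowerSeries_map_surjective`.
[cite: Schlessinger1968, Prop. 2.5 (i)] -/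
theorem mvPowerSeries_relativeLifting_rename {m p : ℕ} (e : Fin m ↪ Fin p) {R₁ R₂ : ArtAlg.{u} k}
    (φ : R₁ →ₐ[k] R₂) (hφ : Function.Surjective φ) (a : MvPowerSeries (Fin p) k →ₐ[k] R₂)
    (b : MvPowerSeries (Fin m) k →ₐ[k] R₁) (hab : φ.comp b = a.comp (MvPowerSeries.rename e)) :
    ∃ a' : MvPowerSeries (Fin p) k →ₐ[k] R₁, φ.comp a' = a ∧ a'.comp (MvPowerSeries.rename e) = b := by
  classical
  choose s hs using fun v => hφ (a (MvPowerSeries.X v))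
  -- values: `b(t_j)` on the base variable `x_{e j}`, a chosen preimage of `a(x_v)` elsewhere
  let f : Fin p → R₁ := fun v => if h : ∃ j, e j = v then b (MvPowerSeries.X h.choose) else s v
  have hf : ∀ v, φ (f v) = a (MvPowerSeries.X v) := by
    intro v
    by_cases h : ∃ j, e j = v
    · simp only [f, dif_pos h]
      have h1 := AlgHom.congr_fun hab (MvPowerSeries.X h.choose)
      rw [AlgHom.comp_apply, AlgHom.comp_apply, MvPowerSeries.rename_X, h.choose_spec] at h1
      exact h1
    · simp only [f, dif_neg h]
      exact hs v
  have hfm : ∀ v, f v ∈ IsLocalRing.maximalIdeal R₁ := fun v => by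
    rw [IsLocalRing.mem_maximalIdeal, mem_nonunits_iff]
    intro hu
    have hu2 : IsUnit (a (MvPowerSeries.X v)) := hf v ▸ hu.map φ
    exact (IsLocalRing.mem_maximalIdeal _).1 (T1Lifting.algHom_X_mem_maximalIdeal k R₂ a v) hu2
  obtain ⟨M, hM1, hM⟩ := T1Lifting.exists_one_le_maximalIdeal_pow_eq_bot k R₁
  obtain ⟨G, -, hG⟩ := T1Lifting.exists_algHom_of_pow_eq_bot k (IsLocalRing.maximalIdeal R₁) M hM1 hM f hfm
  refine ⟨G, T1Lifting.mvPowerSeries_algHom_ext k R₂ _ _ fun v => by rw [AlgHom.comp_apply, hG, hf],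
    T1Lifting.mvPowerSeries_algHom_ext k R₁ _ _ fun j => ?_⟩
  rw [AlgHom.comp_apply, MvPowerSeries.rename_X, hG]
  have h : ∃ j', e j' = e j := ⟨j, rfl⟩
  simp only [f, dif_pos h]
  rw [e.injective h.choose_spec]

/-- **THE RELATIVE FORM OF [FantechiManetti1998ObstructionCalculus, LEMMA 5.6] (iii) ⇒ (i) OVER A FORMAL POWER SERIES
BASE, any field `k`** — the algebra behind the last sentence of the proof of [KawamataNamikawa1994LogDeformations,
Thm. 3.1] (p. 402: «By the T¹-lifting property, we have `δ₂ = 0`. Since `α″` is an isomorphism, we also have `δ₁ = 0`,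
hence the hull `R` of `LD` is formally smooth over `Λ_m`.», where `δ₁` is the obstruction to lifting along
`𝒜_{k+1} → 𝒜_k` for an arbitrary `Λ_m`-algebra structure `𝒜_{k+1}` on `A_{k+1} = ℂ[t]/(t^{k+2})`, p. 401: «for all
`k ≥ 0` and all `Λ_m`-algebra structures on the `A_k`», `Λ_m = ℂ[[t_1, …, t_m]]`).
Setting: `P = k[[x_1, …, x_p]]`, `Λ = k[[t_1, …, t_m]] → P` the renaming `t_j ↦ x_{e j}` along an embedding
`e : Fin m ↪ Fin p` (the remaining variables are the fibre coordinates), `I ⊆ 𝔪_Λ P + 𝔪_P²` an ideal (the relative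
reading of «`I ⊂ 𝔪_P²`»: no fibre variable is redundant), `R = P/I` with its `Λ`-structure `Λ → P → R`. HYPOTHESIS
(relative curvilinear liftings, [FantechiManetti1998ObstructionCalculus, Def. 3.5] for the morphism `h_R → h_Λ`, in the
form of [KawamataNamikawa1994LogDeformations, p. 401]): there is an `N₀` such that for every `N ≥ N₀`, every
`a : R → A_N = k[t]/(t^{N+1})` and every `Λ`-algebra structure `b : Λ → A_{N+1}` compatible with `a`
(`i_N ∘ b = a|_Λ`) there is a lift `a' : R → A_{N+1}` of `a` with `a'|_Λ = b`. CONCLUSION: `I = 0`, i.e. `R = P` IS a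
formal power series ring over `Λ` («formally smooth over `Λ_m`»; [Schlessinger1968, Prop. 2.5 (i)]).
PROOF = the printed weight argument of [FantechiManetti1998ObstructionCalculus, p. 561] run on ALL the variables of
`P` (`T1Lifting.exists_weights`, the weighted curve `T1Lifting.exists_curve` on `P` and on `Λ`, lift-independence
`T1Lifting.prod_pow_eq_of_sub_mem`, truncation `T1Lifting.algHom_eq_zero_of_coeff_eq_zero`), with ONE new point: the
`Λ`-structure of the lift is PRESCRIBED (`a'|_Λ = b` = the weighted curve on the base variables), so a lift agrees with
the curve EXACTLY on the base variables and to first order on the others — which is what a monomial of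
`𝔪_Λ P + 𝔪_P²` needs (`T1Lifting.two_le_degree_or_eq_single_of_coeff_ne_zero`). CONTRAST, printed:
[FantechiManetti1998ObstructionCalculus, Remark p. 562] «the above Lemma 5.6 does not generalize to the relative case;
the best result we can prove is the following: PROPOSITION 5.8 …» (`k = k̄`, conclusion on `S_red → R_red` only) with
the counterexamples Example 5.7 (ii) (base `k[x, y]/(x³, y³)`, tree file `RelativeCurvilinearLiftingNotSmooth.lean`) and
(iii) (base `ℝ[[x, y]]/(x² + y²)`, tree file `RelativeCurvilinearLiftingNonClosedField.lean`) — both over a base that is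
NOT a formal power series ring; over a power series base the relative Lemma 5.6 holds, for every field, as proved here.
This statement is not printed as a lemma in either source (see the module docstring, HONEST SCOPE).
[cite: KawamataNamikawa1994LogDeformations, Thm. 3.1 (proof, p. 402)]
[cite: FantechiManetti1998ObstructionCalculus, Lemma 5.6] -/
theorem powerSeries_ideal_eq_bot_of_relativeCurvilinearLifting {m p : ℕ} (e : Fin m ↪ Fin p)
    (I : Ideal (MvPowerSeries (Fin p) k))
    (hI : I ≤ Ideal.span (Set.range fun j : Fin m => (MvPowerSeries.X (e j) : MvPowerSeries (Fin p) k)) ⊔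
      (IsLocalRing.maximalIdeal (MvPowerSeries (Fin p) k)) ^ 2)
    (N₀ : ℕ)
    (hlift : ∀ N, N₀ ≤ N →
      ∀ (a : (MvPowerSeries (Fin p) k ⧸ I) →ₐ[k] T1Lifting.A k N)
        (b : MvPowerSeries (Fin m) k →ₐ[k] T1Lifting.A k (N + 1)),
        (T1Lifting.i k N).comp b = a.comp ((Ideal.Quotient.mkₐ k I).comp (MvPowerSeries.rename e)) →
        ∃ a' : (MvPowerSeries (Fin p) k ⧸ I) →ₐ[k] T1Lifting.A k (N + 1),
          (T1Lifting.i k N).comp a' = a ∧ a'.comp ((Ideal.Quotient.mkₐ k I).comp (MvPowerSeries.rename e)) = b) :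
    I = ⊥ := by
  classical
  by_contra hne
  obtain ⟨f, hfI, hf0⟩ : ∃ f ∈ I, f ≠ 0 := (Submodule.ne_bot_iff I).1 hne
  -- `C` = the exponents occurring in elements of `I`: degree ≥ 2 or a base variable, never `0`
  set C : Set (Fin p →₀ ℕ) := {J | ∃ g ∈ I, MvPowerSeries.coeff J g ≠ 0} with hC
  have hCne : C.Nonempty := by
    obtain ⟨J, hJ⟩ := (MvPowerSeries.ne_zero_iff_exists_coeff_ne_zero f).1 hf0
    exact ⟨J, f, hfI, hJ⟩
  have hCshape : ∀ J ∈ C, 2 ≤ J.degree ∨ ∃ j, J = Finsupp.single (e j) 1 := fun J ⟨g, hg, hJ⟩ =>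
    T1Lifting.two_le_degree_or_eq_single_of_coeff_ne_zero k e (hI hg) J hJ
  have hC0 : (0 : Fin p →₀ ℕ) ∉ C := fun ⟨g, hg, hJ⟩ => hJ (T1Lifting.coeff_zero_eq_zero_of_mem_sup k e (hI hg))
  -- the weights, with minimal weight `N + 1`, `N ≥ max N₀ 1`, attained only at `J₀`, a monomial of `f₀ ∈ I`
  obtain ⟨a, b, J₀, ⟨f₀, hf₀I, hJ₀f₀⟩, ha1, hLb, hJ₀b, hkey⟩ := T1Lifting.exists_weights C hCne hC0 (max N₀ 1)
  obtain ⟨N, rfl⟩ : ∃ N, b = N + 1 := ⟨b - 1, by omega⟩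
  have hN : N₀ ≤ N := by have := le_max_left N₀ 1; omega
  have hdegw := T1Lifting.degree_le_weight_of_one_le a ha1
  -- the weighted curve `c_N : P → A_N` kills `I`
  obtain ⟨cN, hcN_def⟩ := T1Lifting.exists_curve k N a ha1
  have hsupp : ∀ (g : MvPowerSeries (Fin p) k) (M : ℕ) (J : Fin p →₀ ℕ),
      J ∈ (MvPowerSeries.truncTotal M g).support → MvPowerSeries.coeff J g ≠ 0 ∧ J.degree < M := by
    intro g M J hJ
    have h1 := mem_support_iff.1 hJ
    rw [MvPowerSeries.coeff_truncTotal_eq_ite] at h1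
    by_cases hdeg : J.degree < M
    · rw [if_pos hdeg] at h1
      exact ⟨h1, hdeg⟩
    · rw [if_neg hdeg] at h1
      exact absurd rfl h1
  have hcN : ∀ g, g ∈ I → cN g = 0 := fun g hg => by
    rw [hcN_def, (MvPowerSeries.truncTotal (N + 1) g).as_sum, map_sum]
    refine Finset.sum_eq_zero fun J hJ => ?_
    rw [T1Lifting.aeval_pow_monomial,
      T1Lifting.t_pow_eq_zero_of_lt k (Nat.lt_of_succ_le (hkey J ⟨g, hg, (hsupp g _ J hJ).1⟩).1), mul_zero]
  have hcNX : ∀ v, cN (MvPowerSeries.X v) = T1Lifting.t k N ^ a v := fun v => by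
    rw [hcN_def, ← MvPolynomial.coe_X, (MvPowerSeries.truncTotal_coe_eq_self_iff _ (Nat.succ_ne_zero N)).2
      (by rw [totalDegree_X]; omega), aeval_X]
  -- it descends to `R = P/I`
  set cR : (MvPowerSeries (Fin p) k ⧸ I) →ₐ[k] T1Lifting.A k N := Ideal.Quotient.liftₐ I cN hcN with hcR_def
  have hcR : ∀ g, cR (Ideal.Quotient.mkₐ k I g) = cN g := fun g =>
    AlgHom.congr_fun (Ideal.Quotient.liftₐ_comp I cN hcN) g
  -- THE PRESCRIBED `Λ`-STRUCTURE ON `A_{N+1}`: the weighted curve on the base variables, `t_j ↦ t^{a(e j)}`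
  obtain ⟨bΛ, hbΛ_def⟩ := T1Lifting.exists_curve k (N + 1) (fun j => a (e j)) (fun j => ha1 (e j))
  have hbΛX : ∀ j, bΛ (MvPowerSeries.X j) = T1Lifting.t k (N + 1) ^ a (e j) := fun j => by
    rw [hbΛ_def, ← MvPolynomial.coe_X, (MvPowerSeries.truncTotal_coe_eq_self_iff _ (Nat.succ_ne_zero (N + 1))).2
      (by rw [totalDegree_X]; omega), aeval_X]
  have hcompat : (T1Lifting.i k N).comp bΛ = cR.comp ((Ideal.Quotient.mkₐ k I).comp (MvPowerSeries.rename e)) :=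
    T1Lifting.mvPowerSeries_algHom_ext k (T1Lifting.artA k N) _ _ fun j => by
      rw [AlgHom.comp_apply, hbΛX, map_pow, T1Lifting.i_t, AlgHom.comp_apply, AlgHom.comp_apply,
        MvPowerSeries.rename_X, hcR, hcNX]
  -- the relative curvilinear lifting hypothesis at level `N ≥ N₀`
  obtain ⟨ψ, hψ, hψΛ⟩ := hlift N hN cR bΛ hcompat
  set Ψ : MvPowerSeries (Fin p) k →ₐ[k] T1Lifting.A k (N + 1) := ψ.comp (Ideal.Quotient.mkₐ k I) with hΨ_def
  set y : Fin p → T1Lifting.A k (N + 1) := fun v => Ψ (MvPowerSeries.X v) with hy_def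
  set z : Fin p → T1Lifting.A k (N + 1) := fun v => T1Lifting.t k (N + 1) ^ a v with hz_def
  -- `y_v ≡ z_v = t^{a_v}` modulo `K = ker i = (t^{N+1})`, with EQUALITY on the base variables
  have hiy : ∀ v, T1Lifting.i k N (y v) = T1Lifting.t k N ^ a v := fun v =>
    calc T1Lifting.i k N (y v) = ((T1Lifting.i k N).comp ψ) (Ideal.Quotient.mkₐ k I (MvPowerSeries.X v)) := rfl
      _ = cR (Ideal.Quotient.mkₐ k I (MvPowerSeries.X v)) := by rw [hψ]
      _ = T1Lifting.t k N ^ a v := by rw [hcR, hcNX]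
  have hybase : ∀ j, y (e j) = z (e j) := fun j =>
    calc y (e j) = (ψ.comp ((Ideal.Quotient.mkₐ k I).comp (MvPowerSeries.rename e))) (MvPowerSeries.X j) := by
          rw [AlgHom.comp_apply, AlgHom.comp_apply, MvPowerSeries.rename_X]
          rfl
      _ = T1Lifting.t k (N + 1) ^ a (e j) := by rw [hψΛ, hbΛX]
  set K : Ideal (T1Lifting.A k (N + 1)) := Ideal.span {T1Lifting.t k (N + 1) ^ (N + 1)} with hK
  set 𝔪 : Ideal (T1Lifting.A k (N + 1)) := Ideal.span {T1Lifting.t k (N + 1)} with h𝔪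
  have hKm : K ≤ 𝔪 :=
    Ideal.span_singleton_le_span_singleton.2 (dvd_pow_self _ (Nat.succ_ne_zero N))
  have hmK : ∀ x ∈ 𝔪, ∀ w ∈ K, x * w = 0 := by
    intro x hx w hw
    obtain ⟨u, rfl⟩ := Ideal.mem_span_singleton'.1 hx
    obtain ⟨v, rfl⟩ := Ideal.mem_span_singleton'.1 hw
    calc u * T1Lifting.t k (N + 1) * (v * T1Lifting.t k (N + 1) ^ (N + 1))
        = u * v * T1Lifting.t k (N + 1) ^ (N + 1 + 1) := by ring
      _ = 0 := by rw [T1Lifting.t_pow_succ, mul_zero]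
  have h𝔪pow : 𝔪 ^ (N + 2) = ⊥ := by
    rw [h𝔪, Ideal.span_singleton_pow, Ideal.span_singleton_eq_bot]
    exact T1Lifting.t_pow_succ k (N + 1)
  have hyz : ∀ v, y v - z v ∈ K := fun v => by
    have h0 : T1Lifting.i k N (y v - z v) = 0 := by
      rw [map_sub, hiy, hz_def, map_pow, T1Lifting.i_t, sub_self]
    obtain ⟨c, hc⟩ := T1Lifting.exists_eq_smul_of_i_eq_zero k N h0
    rw [hc, Algebra.smul_def]
    exact K.mul_mem_left _ (Ideal.subset_span rfl)
  have hz : ∀ v, z v ∈ 𝔪 := fun v =>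
    Ideal.mem_span_singleton'.2 ⟨T1Lifting.t k (N + 1) ^ (a v - 1), by
      rw [hz_def, ← pow_succ, Nat.sub_add_cancel (ha1 v)]⟩
  have hy : ∀ v, y v ∈ 𝔪 := fun v => by
    have := 𝔪.add_mem (hKm (hyz v)) (hz v)
    rwa [sub_add_cancel] at this
  -- `Ψ` is computed on the truncation below degree `N + 2`, where it is `aeval y`, which agrees with `aeval z` on `I`
  have hΨpoly : ∀ q : MvPolynomial (Fin p) k, Ψ (↑q) = aeval y q := fun q => by
    induction q using MvPolynomial.induction_on with
    | C c =>
      rw [MvPolynomial.coe_C, algHom_C, MvPowerSeries.c_eq_algebraMap, AlgHom.commutes]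
    | add q q' hq hq' => rw [MvPolynomial.coe_add, map_add, map_add, hq, hq']
    | mul_X q v hq => rw [MvPolynomial.coe_mul, MvPolynomial.coe_X, map_mul, map_mul, hq, aeval_X]
  have hΨtrunc : ∀ g, Ψ g = Ψ ↑(MvPowerSeries.truncTotal (N + 2) g) := fun g => by
    rw [← sub_eq_zero, ← map_sub]
    refine T1Lifting.algHom_eq_zero_of_coeff_eq_zero k Ψ 𝔪 (N + 2) h𝔪pow hy _ fun d hd => ?_
    rw [map_sub, MvPolynomial.coeff_coe, MvPowerSeries.coeff_truncTotal _ hd, sub_self]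
  have hagree : ∀ g ∈ I, Ψ g = aeval z (MvPowerSeries.truncTotal (N + 2) g) := fun g hg => by
    rw [hΨtrunc g, hΨpoly, (MvPowerSeries.truncTotal (N + 2) g).as_sum, map_sum, map_sum]
    refine Finset.sum_congr rfl fun J hJ => ?_
    rw [aeval_monomial, aeval_monomial]
    rcases hCshape J ⟨g, hg, (hsupp g _ J hJ).1⟩ with h2 | ⟨j, rfl⟩
    · obtain ⟨a', b', hab⟩ := T1Lifting.exists_single_add_single_le_of_two_le J h2
      rw [T1Lifting.prod_pow_eq_of_sub_mem 𝔪 K hmK y z hy hz hyz J a' b' hab]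
    · rw [Finsupp.prod_single_index (h := fun v n => y v ^ n) (pow_zero _),
        Finsupp.prod_single_index (h := fun v n => z v ^ n) (pow_zero _), pow_one, pow_one, hybase]
  -- `aeval z (trunc f₀) = coeff_{J₀}(f₀) · t^{N+1} ≠ 0`
  have hJ₀deg : J₀.degree < N + 2 := by have := hdegw J₀; omega
  have hzf₀ : aeval z (MvPowerSeries.truncTotal (N + 2) f₀) =
      algebraMap k _ (MvPowerSeries.coeff J₀ f₀) * T1Lifting.t k (N + 1) ^ (N + 1) := by
    rw [(MvPowerSeries.truncTotal (N + 2) f₀).as_sum, map_sum, Finset.sum_eq_single J₀]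
    · rw [hz_def, T1Lifting.aeval_pow_monomial, hJ₀b, MvPowerSeries.coeff_truncTotal _ hJ₀deg]
    · intro J hJ hJne
      have h1 := hkey J ⟨f₀, hf₀I, (hsupp f₀ _ J hJ).1⟩
      have hlt : N + 1 < ∑ i, a i * J i := lt_of_le_of_ne h1.1 fun h => hJne (h1.2 h.symm)
      rw [hz_def, T1Lifting.aeval_pow_monomial, T1Lifting.t_pow_eq_zero_of_lt k hlt, mul_zero]
    · intro hnot
      exfalso
      apply hnot
      rw [mem_support_iff, MvPowerSeries.coeff_truncTotal _ hJ₀deg]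
      exact hJ₀f₀
  -- but `Ψ(f₀) = ψ(0) = 0`
  have hΨf₀ : Ψ f₀ = 0 := by
    change ψ (Ideal.Quotient.mkₐ k I f₀) = 0
    rw [Ideal.Quotient.mkₐ_eq_mk, Ideal.Quotient.eq_zero_iff_mem.2 hf₀I, map_zero]
  have hzero : algebraMap k _ (MvPowerSeries.coeff J₀ f₀) * T1Lifting.t k (N + 1) ^ (N + 1) = 0 := by
    rw [← hzf₀, ← hagree f₀ hf₀I]
    exact hΨf₀
  have hunit : IsUnit (algebraMap k (T1Lifting.A k (N + 1)) (MvPowerSeries.coeff J₀ f₀)) :=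
    (Ne.isUnit hJ₀f₀).map _
  exact T1Lifting.t_pow_ne_zero k (N + 1) ((hunit.mul_right_eq_zero).1 hzero)

/-- (i) ⇒ «smooth over `Λ`» for the PRESENTED quotient `P/I` with `I = 0`: relative liftings of `h_{P/I} → h_Λ` along
every surjection of `Art_k` (`mvPowerSeries_relativeLifting_rename` transported through `P/0 = P`).
[cite: Schlessinger1968, Prop. 2.5 (i)] -/
theorem relativeLifting_quotient_of_eq_bot {m p : ℕ} (e : Fin m ↪ Fin p) (I : Ideal (MvPowerSeries (Fin p) k))
    (hI0 : I = ⊥) {R₁ R₂ : ArtAlg.{u} k} (φ : R₁ →ₐ[k] R₂) (hφ : Function.Surjective φ)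
    (a : (MvPowerSeries (Fin p) k ⧸ I) →ₐ[k] R₂) (b : MvPowerSeries (Fin m) k →ₐ[k] R₁)
    (hab : φ.comp b = a.comp ((Ideal.Quotient.mkₐ k I).comp (MvPowerSeries.rename e))) :
    ∃ a' : (MvPowerSeries (Fin p) k ⧸ I) →ₐ[k] R₁,
      φ.comp a' = a ∧ a'.comp ((Ideal.Quotient.mkₐ k I).comp (MvPowerSeries.rename e)) = b := by
  subst hI0
  obtain ⟨G, hG, hGb⟩ := mvPowerSeries_relativeLifting_rename k e φ hφ (a.comp (Ideal.Quotient.mkₐ k ⊥)) b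
    (by rw [AlgHom.comp_assoc]; exact hab)
  refine ⟨Ideal.Quotient.liftₐ ⊥ G (fun x hx => by rw [(Submodule.mem_bot _).1 hx, map_zero]), ?_, ?_⟩
  · refine Ideal.Quotient.algHom_ext k ?_
    rw [AlgHom.comp_assoc, Ideal.Quotient.liftₐ_comp]
    exact hG
  · rw [← AlgHom.comp_assoc, Ideal.Quotient.liftₐ_comp]
    exact hGb

/-- **THE RELATIVE [FantechiManetti1998ObstructionCalculus, LEMMA 5.6], (i) ⟺ (iii), OVER A FORMAL POWER SERIES BASE**
(printed absolute form, p. 561: «Let `R ∈ Ârt_k`. Then the following are equivalent: (i) the functor `h_R` is smooth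
(hence `R` is a power series algebra); … (iii) there exists `N₀ ∈ ℕ` such that the map `h_R(k[t]/t^{N+1}) → h_R(k[t]/t^N)`
is surjective for `N ≥ N₀`.»), in the setting of `powerSeries_ideal_eq_bot_of_relativeCurvilinearLifting`
(`R = P/I` over `Λ = k[[t_1, …, t_m]]`, `I ⊆ 𝔪_Λ P + 𝔪_P²`, any field `k`), with (i) read as `I = 0` («`R` is a power series
ring over `Λ`») and (iii) as the relative curvilinear liftings for every `Λ`-algebra structure on `A_{N+1}`, `N ≥ N₀`
([KawamataNamikawa1994LogDeformations, p. 401]: «for all `k ≥ 0` and all `Λ_m`-algebra structures on the `A_k`»).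
(⇒: `relativeLifting_quotient_of_eq_bot`; ⇐: `powerSeries_ideal_eq_bot_of_relativeCurvilinearLifting`.)
[cite: FantechiManetti1998ObstructionCalculus, Lemma 5.6] [cite: KawamataNamikawa1994LogDeformations, Thm. 3.1 (proof, p. 402)] -/
theorem powerSeries_ideal_eq_bot_iff_relativeCurvilinearLifting {m p : ℕ} (e : Fin m ↪ Fin p)
    (I : Ideal (MvPowerSeries (Fin p) k))
    (hI : I ≤ Ideal.span (Set.range fun j : Fin m => (MvPowerSeries.X (e j) : MvPowerSeries (Fin p) k)) ⊔
      (IsLocalRing.maximalIdeal (MvPowerSeries (Fin p) k)) ^ 2) :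
    I = ⊥ ↔ ∃ N₀ : ℕ, ∀ N, N₀ ≤ N →
      ∀ (a : (MvPowerSeries (Fin p) k ⧸ I) →ₐ[k] T1Lifting.A k N)
        (b : MvPowerSeries (Fin m) k →ₐ[k] T1Lifting.A k (N + 1)),
        (T1Lifting.i k N).comp b = a.comp ((Ideal.Quotient.mkₐ k I).comp (MvPowerSeries.rename e)) →
        ∃ a' : (MvPowerSeries (Fin p) k ⧸ I) →ₐ[k] T1Lifting.A k (N + 1),
          (T1Lifting.i k N).comp a' = a ∧ a'.comp ((Ideal.Quotient.mkₐ k I).comp (MvPowerSeries.rename e)) = b := by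
  constructor
  · intro h0
    exact ⟨0, fun N _ a b hab => relativeLifting_quotient_of_eq_bot k e I h0 (R₁ := T1Lifting.artA k (N + 1))
      (R₂ := T1Lifting.artA k N) (T1Lifting.i k N) (T1Lifting.i_surjective k N) a b hab⟩
  · rintro ⟨N₀, h⟩
    exact powerSeries_ideal_eq_bot_of_relativeCurvilinearLifting k e I hI N₀ h

/-- **[Schlessinger1968, PROP. 2.5 (i)] OVER A FORMAL POWER SERIES BASE, for presented algebras** (Trans. AMS 130,
p. 211: «Let `R → S` be a morphism in `Ĉ`. Then `h_S → h_R` is smooth if and only if `S` is a power series ring over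
`R`.»; smoothness of a morphism of functors as in [Schlessinger1968, Def. 2.2, p. 210]: «for any surjection `B → A` in
`C`, the morphism `F(B) → F(A) ×_{G(A)} G(B)` is surjective»), here at `R = Λ = k[[t_1, …, t_m]]` and for a PRESENTED
`S = P/I`, `P = k[[x_1, …, x_p]] ⊇ Λ` (`t_j ↦ x_{e j}`), `I ⊆ 𝔪_Λ P + 𝔪_P²`, with «`S` is a power series ring over
`R`» read as `I = 0`: `I = 0` iff for every surjection `φ : R₁ → R₂` of `Art_k` every compatible pair
(`a : S → R₂`, `b : Λ → R₁`, `φ ∘ b = a|_Λ`) has a lift `a' : S → R₁`, `φ ∘ a' = a`, `a'|_Λ = b`. (⇒: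
`relativeLifting_quotient_of_eq_bot`; ⇐: already the curvilinear surjections `A_{N+1} → A_N` with all `Λ`-structures
suffice, `powerSeries_ideal_eq_bot_of_relativeCurvilinearLifting`.) The tree's absolute case `Λ = k`:
`powerSeries_ideal_eq_bot_iff_points_smooth`. The general «only if» of Prop. 2.5 (i) (arbitrary `R ∈ Ĉ`) is not typed
here. [cite: Schlessinger1968, Prop. 2.5 (i)] -/
theorem powerSeries_ideal_eq_bot_iff_relativelySmooth {m p : ℕ} (e : Fin m ↪ Fin p)
    (I : Ideal (MvPowerSeries (Fin p) k))
    (hI : I ≤ Ideal.span (Set.range fun j : Fin m => (MvPowerSeries.X (e j) : MvPowerSeries (Fin p) k)) ⊔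
      (IsLocalRing.maximalIdeal (MvPowerSeries (Fin p) k)) ^ 2) :
    I = ⊥ ↔ ∀ (R₁ R₂ : ArtAlg.{u} k) (φ : R₁ →ₐ[k] R₂), Function.Surjective φ →
      ∀ (a : (MvPowerSeries (Fin p) k ⧸ I) →ₐ[k] R₂) (b : MvPowerSeries (Fin m) k →ₐ[k] R₁),
        φ.comp b = a.comp ((Ideal.Quotient.mkₐ k I).comp (MvPowerSeries.rename e)) →
        ∃ a' : (MvPowerSeries (Fin p) k ⧸ I) →ₐ[k] R₁,
          φ.comp a' = a ∧ a'.comp ((Ideal.Quotient.mkₐ k I).comp (MvPowerSeries.rename e)) = b := by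
  constructor
  · intro h0 R₁ R₂ φ hφ a b hab
    exact relativeLifting_quotient_of_eq_bot k e I h0 φ hφ a b hab
  · intro h
    exact powerSeries_ideal_eq_bot_of_relativeCurvilinearLifting k e I hI 0 fun N _ a b hab =>
      h (T1Lifting.artA k (N + 1)) (T1Lifting.artA k N) (T1Lifting.i k N) (T1Lifting.i_surjective k N) a b hab

/-- **THE CRITERION IN THE WORDS OF [KawamataNamikawa1994LogDeformations, §3]** (p. 401: «Let `𝒜_k` and `𝒜_k[ε]` be
`Λ_m`-algebras whose underlying `ℂ`-algebras are `A_k` and `A_k[ε]`, respectively. … We always assume that the images of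
the `t_i` are in the maximal ideals for `k ≥ 0`, and the natural homomorphisms `𝒜_k → 𝒜_{k−1}`, … are over `Λ_m` for
all `k`. … for all `k ≥ 0` and all `Λ_m`-algebra structures on the `A_k`»; proof of Thm. 3.1, p. 401–402: «We fix a
`Λ_m`-algebra structure `𝒜_{k+1}` on `A_{k+1}` for some `k ≥ 0`. … we also have `δ₁ = 0`, hence the hull `R` of `LD` is
formally smooth over `Λ_m`.»): a `Λ`-algebra structure on `A_{N+1} = k[t]/(t^{N+2})` IS a family `σ` of images of the
`t_j` (necessarily in the maximal ideal; `T1Lifting.exists_algHom_of_pow_eq_bot` / `T1Lifting.mvPowerSeries_algHom_ext`),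
so the hypothesis reads: for every `N ≥ N₀`, every `a : R → A_N` (`R = P/I` as above) and every family
`σ_j ∈ A_{N+1}` over the `a(t_j) ∈ A_N` there is a lift `a' : R → A_{N+1}` of `a` with `a'(t_j) = σ_j`. CONCLUSION:
`I = 0` — `R` is a formal power series ring over `Λ`, i.e. «formally smooth over `Λ_m`». For `LD` itself (a
pro-representable functor on `Art_{Λ_m}`, [KawamataNamikawa1994LogDeformations, Thm. 3.1]) nothing is instantiated here.
[cite: KawamataNamikawa1994LogDeformations, Thm. 3.1 (proof, p. 402)] -/
theorem powerSeries_ideal_eq_bot_of_forall_structures_lifting {m p : ℕ} (e : Fin m ↪ Fin p)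
    (I : Ideal (MvPowerSeries (Fin p) k))
    (hI : I ≤ Ideal.span (Set.range fun j : Fin m => (MvPowerSeries.X (e j) : MvPowerSeries (Fin p) k)) ⊔
      (IsLocalRing.maximalIdeal (MvPowerSeries (Fin p) k)) ^ 2)
    (N₀ : ℕ)
    (h : ∀ N, N₀ ≤ N →
      ∀ (a : (MvPowerSeries (Fin p) k ⧸ I) →ₐ[k] T1Lifting.A k N) (σ : Fin m → T1Lifting.A k (N + 1)),
        (∀ j, T1Lifting.i k N (σ j) = a (Ideal.Quotient.mk I (MvPowerSeries.X (e j)))) →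
        ∃ a' : (MvPowerSeries (Fin p) k ⧸ I) →ₐ[k] T1Lifting.A k (N + 1),
          (T1Lifting.i k N).comp a' = a ∧ ∀ j, a' (Ideal.Quotient.mk I (MvPowerSeries.X (e j))) = σ j) :
    I = ⊥ :=
  powerSeries_ideal_eq_bot_of_relativeCurvilinearLifting k e I hI N₀ fun N hN a b hab => by
    obtain ⟨a', ha', hσ⟩ := h N hN a (fun j => b (MvPowerSeries.X j)) fun j => by
      have h1 := AlgHom.congr_fun hab (MvPowerSeries.X j)
      rw [AlgHom.comp_apply, AlgHom.comp_apply, AlgHom.comp_apply, MvPowerSeries.rename_X,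
        Ideal.Quotient.mkₐ_eq_mk] at h1
      exact h1
    refine ⟨a', ha', T1Lifting.mvPowerSeries_algHom_ext k (T1Lifting.artA k (N + 1)) _ _ fun j => ?_⟩
    rw [AlgHom.comp_apply, AlgHom.comp_apply, MvPowerSeries.rename_X, Ideal.Quotient.mkₐ_eq_mk, hσ]

/-- A CONSEQUENCE, by hand (for readers asking for a FORMAL SECTION of `Spec R → Spec Λ`): under the hypotheses of
`powerSeries_ideal_eq_bot_of_relativeCurvilinearLifting`, the `Λ`-algebra `R = P/I` retracts onto `Λ` — there is a
`k`-algebra map `r : R → Λ` with `r ∘ (Λ → R) = id` (since `I = 0`: kill the fibre variables, `MvPowerSeries.killCompl e`).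
This is the trivial half of «`S` is a power series ring over `R`» ⇒ sections exist; nothing geometric is asserted.
[cite: Schlessinger1968, Prop. 2.5 (i)] -/
theorem exists_retraction_of_relativeCurvilinearLifting {m p : ℕ} (e : Fin m ↪ Fin p)
    (I : Ideal (MvPowerSeries (Fin p) k))
    (hI : I ≤ Ideal.span (Set.range fun j : Fin m => (MvPowerSeries.X (e j) : MvPowerSeries (Fin p) k)) ⊔
      (IsLocalRing.maximalIdeal (MvPowerSeries (Fin p) k)) ^ 2)
    (N₀ : ℕ)
    (hlift : ∀ N, N₀ ≤ N →
      ∀ (a : (MvPowerSeries (Fin p) k ⧸ I) →ₐ[k] T1Lifting.A k N)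
        (b : MvPowerSeries (Fin m) k →ₐ[k] T1Lifting.A k (N + 1)),
        (T1Lifting.i k N).comp b = a.comp ((Ideal.Quotient.mkₐ k I).comp (MvPowerSeries.rename e)) →
        ∃ a' : (MvPowerSeries (Fin p) k ⧸ I) →ₐ[k] T1Lifting.A k (N + 1),
          (T1Lifting.i k N).comp a' = a ∧ a'.comp ((Ideal.Quotient.mkₐ k I).comp (MvPowerSeries.rename e)) = b) :
    ∃ r : (MvPowerSeries (Fin p) k ⧸ I) →ₐ[k] MvPowerSeries (Fin m) k,
      r.comp ((Ideal.Quotient.mkₐ k I).comp (MvPowerSeries.rename e)) = AlgHom.id k _ := by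
  have h0 := powerSeries_ideal_eq_bot_of_relativeCurvilinearLifting k e I hI N₀ hlift
  subst h0
  refine ⟨Ideal.Quotient.liftₐ ⊥ (MvPowerSeries.killCompl e)
    (fun x hx => by rw [(Submodule.mem_bot _).1 hx, map_zero]), ?_⟩
  rw [← AlgHom.comp_assoc, Ideal.Quotient.liftₐ_comp, MvPowerSeries.killCompl_comp_rename]

/-! ### The first half of the proof of [KawamataNamikawa1994LogDeformations, Thm. 3.1]: relative T¹-lifting ⇒ the
liftings along `𝒜_{k+1} → 𝒜_k` for every `Λ`-structure — here by the cartesian squares of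
[FantechiManetti1999T1Lifting, p. 3] («essentially Kawamata's proof»), for ANY functor of Artin rings `F` with (H₄)
([FantechiManetti1998ObstructionCalculus, Def. 2.7]; e.g. every `h_R`, `ArtinFunctor.points_H4`) RELATIVE to ANY `k`-algebra
`Λ'` through a natural transformation `ν : F → h_{Λ'}` (components `ν_X : F(X) → Hom_k(Λ', X)`, naturality `hn`). -/

section H4Functors

variable {k}

/-- RELATIVE FORM OF `ArtinFunctor.map_j_succ_surjective_of_t1Lifting` ([FantechiManetti1999T1Lifting, p. 3,
l. 13–21]: «the T¹-lifting condition can be rephrased by saying that, given a `c ∈ F(C_n)`, there exists `b ∈ F(B_n)`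
having the same projections to `B_{n−1}` and `A_n`. If `F` satisfies (H4), then the T¹-lifting condition becomes that
`F(B_n) → F(C_n)` is onto»), for a functor `F` with (H₄) over `h_{Λ'}` (`ν : F → h_{Λ'}` natural): the relative
T¹-lifting property in the fibre-product form of [KawamataNamikawa1994LogDeformations, p. 401]
(«`LD(𝒜_k[ε]) → LD(𝒜_k) ×_{LD(𝒜_{k−1})} LD(𝒜_{k−1}[ε])` surjective … for all `Λ_m`-algebra structures», `k = n + 1`:
compatible `bpt ∈ F(B_n)`, `apt ∈ F(A_{n+1})` lift to `F(B_{n+1})` with ANY prescribed compatible `Λ'`-structure on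
`B_{n+1}`) gives the relative `C`-form at `n + 1`: every `c ∈ F(C_{n+1})` lifts along `j : B_{n+1} → C_{n+1}` with any
prescribed compatible `Λ'`-structure (square `C_{n+1} = B_n ×_{A_n} A_{n+1}`, `T1Lifting.isCartesian_gC_jB`, (H₄) of `F`).
[cite: FantechiManetti1999T1Lifting, p. 3] [cite: KawamataNamikawa1994LogDeformations, Thm. 3.1 (proof, p. 402)] -/
theorem ArtinFunctor.relative_map_j_succ_surjective_of_relativeT1Lifting (F : ArtinFunctor.{u} k) (h4 : F.H4)
    (Λ' : Type u) [CommRing Λ'] [Algebra k Λ'] (ν : ∀ X : ArtAlg.{u} k, F.obj X → (Λ' →ₐ[k] X))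
    (hn : ∀ ⦃X Y : ArtAlg.{u} k⦄ (φ : X →ₐ[k] Y) (x : F.obj X), ν Y (F.map φ x) = φ.comp (ν X x)) (n : ℕ)
    (hT : ∀ (bpt : F.obj (T1Lifting.artB k n)) (apt : F.obj (T1Lifting.artA k (n + 1))),
      F.map (R := T1Lifting.artB k n) (S := T1Lifting.artA k n) (T1Lifting.bA k n) bpt =
        F.map (R := T1Lifting.artA k (n + 1)) (S := T1Lifting.artA k n) (T1Lifting.i k n) apt →
      ∀ βΛ : Λ' →ₐ[k] T1Lifting.B k (n + 1), (T1Lifting.β k n).comp βΛ = ν (T1Lifting.artB k n) bpt →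
        (T1Lifting.bA k (n + 1)).comp βΛ = ν (T1Lifting.artA k (n + 1)) apt →
        ∃ b' : F.obj (T1Lifting.artB k (n + 1)),
          F.map (R := T1Lifting.artB k (n + 1)) (S := T1Lifting.artB k n) (T1Lifting.β k n) b' = bpt ∧
          F.map (R := T1Lifting.artB k (n + 1)) (S := T1Lifting.artA k (n + 1)) (T1Lifting.bA k (n + 1)) b' = apt ∧
          ν (T1Lifting.artB k (n + 1)) b' = βΛ)
    (c : F.obj (T1Lifting.artC k (n + 1))) (βΛ : Λ' →ₐ[k] T1Lifting.B k (n + 1))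
    (hc : (T1Lifting.j k (n + 1)).comp βΛ = ν (T1Lifting.artC k (n + 1)) c) :
    ∃ b' : F.obj (T1Lifting.artB k (n + 1)),
      F.map (R := T1Lifting.artB k (n + 1)) (S := T1Lifting.artC k (n + 1)) (T1Lifting.j k (n + 1)) b' = c ∧
      ν (T1Lifting.artB k (n + 1)) b' = βΛ := by
  have h4F := h4 (R₀ := T1Lifting.artA k n) (R₁ := T1Lifting.artA k (n + 1)) (R₂ := T1Lifting.artB k n)
    (R₃ := T1Lifting.artC k (n + 1)) (T1Lifting.i k n) (T1Lifting.bA k n) (T1Lifting.gC k n) (T1Lifting.jB k n)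
    (T1Lifting.isCartesian_gC_jB k n) (T1Lifting.isSmallExtension_i k n)
  have hcomp : F.map (R := T1Lifting.artB k n) (S := T1Lifting.artA k n) (T1Lifting.bA k n)
        (F.map (R := T1Lifting.artC k (n + 1)) (S := T1Lifting.artB k n) (T1Lifting.jB k n) c) =
      F.map (R := T1Lifting.artA k (n + 1)) (S := T1Lifting.artA k n) (T1Lifting.i k n)
        (F.map (R := T1Lifting.artC k (n + 1)) (S := T1Lifting.artA k (n + 1)) (T1Lifting.gC k n) c) := by
    rw [← F.map_comp, ← F.map_comp]
    exact congrArg (fun φ => F.map (R := T1Lifting.artC k (n + 1)) (S := T1Lifting.artA k n) φ c)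
      (T1Lifting.i_comp_gC k n).symm
  obtain ⟨b', hb'1, hb'2, hb'3⟩ := hT _ _ hcomp βΛ
    (by rw [hn, ← hc, ← AlgHom.comp_assoc, T1Lifting.jB_comp_j])
    (by rw [hn, ← hc, ← AlgHom.comp_assoc, T1Lifting.gC_comp_j])
  refine ⟨b', h4F.2 _ _ ?_ ?_, hb'3⟩
  · rw [← F.map_comp]
    exact (congrArg (fun φ => F.map (R := T1Lifting.artB k (n + 1)) (S := T1Lifting.artA k (n + 1)) φ b')
      (T1Lifting.gC_comp_j k n)).trans hb'2
  · rw [← F.map_comp]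
    exact (congrArg (fun φ => F.map (R := T1Lifting.artB k (n + 1)) (S := T1Lifting.artB k n) φ b')
      (T1Lifting.jB_comp_j k n)).trans hb'1

/-- **KAWAMATA'S ARGUMENT ONE INDEX AT A TIME, RELATIVE TO A BASE** — the relative form of
`ArtinFunctor.map_i_surjective_of_map_j_surjective` ([FantechiManetti1999T1Lifting, p. 3, l. 21–25]: «The cartesian
diagram (in characteristic zero) [`A_{m+1} = B_m ×_{C_m} A_m`] together with condition (H1) immediately implies that
`j : F(A_{m+1}) → F(A_m)` is surjective …; in fact, this is essentially Kawamata's proof»; in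
[KawamataNamikawa1994LogDeformations, proof of Thm. 3.1, p. 401–402] the same step is run through the obstruction
spaces of `LD` with `α : t ↦ t + ε` and `α″ : t^{k+1} ↦ (k+1) t^k ε`, «Since `α″` is an isomorphism, we also have
`δ₁ = 0`» — characteristic zero at the same place): for a functor `F` with (H₄) over `h_{Λ'}` (`ν : F → h_{Λ'}` natural),
if every `c ∈ F(C_m)` lifts along `j : B_m → C_m` with any prescribed compatible `Λ'`-structure on `B_m`, then every
`a ∈ F(A_m)` lifts along `i : A_{m+1} → A_m` with any prescribed compatible `Λ'`-structure on `A_{m+1}` (`char k = 0`):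
push `a` to `C_m` by `fC`, give `B_m` the structure `fB ∘ bA'`, lift, glue in `A_{m+1} = B_m ×_{C_m} A_m`
(`T1Lifting.isCartesian_fB_i`, (H₄) of `F`), and read off the `Λ'`-structure of the glued element by (H₄) of `h_{Λ'}`.
[cite: FantechiManetti1999T1Lifting, p. 3] [cite: KawamataNamikawa1994LogDeformations, Thm. 3.1 (proof, p. 402)] -/
theorem ArtinFunctor.relative_map_i_surjective_of_relative_map_j_surjective [CharZero k] (F : ArtinFunctor.{u} k)
    (h4 : F.H4) (Λ' : Type u) [CommRing Λ'] [Algebra k Λ'] (ν : ∀ X : ArtAlg.{u} k, F.obj X → (Λ' →ₐ[k] X))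
    (hn : ∀ ⦃X Y : ArtAlg.{u} k⦄ (φ : X →ₐ[k] Y) (x : F.obj X), ν Y (F.map φ x) = φ.comp (ν X x)) (m : ℕ)
    (hj : ∀ (c : F.obj (T1Lifting.artC k m)) (b : Λ' →ₐ[k] T1Lifting.B k m),
      (T1Lifting.j k m).comp b = ν (T1Lifting.artC k m) c →
      ∃ b' : F.obj (T1Lifting.artB k m),
        F.map (R := T1Lifting.artB k m) (S := T1Lifting.artC k m) (T1Lifting.j k m) b' = c ∧
        ν (T1Lifting.artB k m) b' = b)
    (a : F.obj (T1Lifting.artA k m)) (bA' : Λ' →ₐ[k] T1Lifting.A k (m + 1))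
    (hab : (T1Lifting.i k m).comp bA' = ν (T1Lifting.artA k m) a) :
    ∃ a' : F.obj (T1Lifting.artA k (m + 1)),
      F.map (R := T1Lifting.artA k (m + 1)) (S := T1Lifting.artA k m) (T1Lifting.i k m) a' = a ∧
      ν (T1Lifting.artA k (m + 1)) a' = bA' := by
  obtain ⟨η, hη, hην⟩ := hj (F.map (R := T1Lifting.artA k m) (S := T1Lifting.artC k m) (T1Lifting.fC k m) a)
    ((T1Lifting.fB k m).comp bA')
    (by rw [hn, ← hab, ← AlgHom.comp_assoc, ← AlgHom.comp_assoc, T1Lifting.j_comp_fB])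
  have h4F := h4 (R₀ := T1Lifting.artC k m) (R₁ := T1Lifting.artB k m) (R₂ := T1Lifting.artA k m)
    (R₃ := T1Lifting.artA k (m + 1)) (T1Lifting.j k m) (T1Lifting.fC k m) (T1Lifting.fB k m) (T1Lifting.i k m)
    (T1Lifting.isCartesian_fB_i k m) (T1Lifting.isSmallExtension_j k m)
  have h4Λ := ArtinFunctor.points_H4 (k := k) Λ' (R₀ := T1Lifting.artC k m) (R₁ := T1Lifting.artB k m)
    (R₂ := T1Lifting.artA k m) (R₃ := T1Lifting.artA k (m + 1)) (T1Lifting.j k m) (T1Lifting.fC k m)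
    (T1Lifting.fB k m) (T1Lifting.i k m) (T1Lifting.isCartesian_fB_i k m) (T1Lifting.isSmallExtension_j k m)
  obtain ⟨w, hwB, hwA⟩ := h4F.1 η a hη
  refine ⟨w, hwA, h4Λ.2 (ν _ w) bA' ?_ ?_⟩
  · change (T1Lifting.fB k m).comp (ν _ w) = (T1Lifting.fB k m).comp bA'
    rw [← hην, ← hwB, hn (X := T1Lifting.artA k (m + 1)) (Y := T1Lifting.artB k m)]
  · change (T1Lifting.i k m).comp (ν _ w) = (T1Lifting.i k m).comp bA'
    rw [hab, ← hwA, hn (X := T1Lifting.artA k (m + 1)) (Y := T1Lifting.artA k m)]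

/-- The easy converse of the two steps, for `F` with (H₄) over `h_{Λ'}`: if `F → h_{Λ'}` lifts along EVERY surjection of
`Art_k` (smooth in the sense of [Schlessinger1968, Def. 2.2]) then it has the relative T¹-lifting property in the
fibre-product form (lift the compatible pair to `F(C_{n+1})`, `C_{n+1} = B_n ×_{A_n} A_{n+1}`, by (H₄); compare the
`Λ'`-structures there by (H₄) of `h_{Λ'}`; lift along the surjection `j : B_{n+1} → C_{n+1}`) — the relative reading of
[FantechiManetti1999T1Lifting, p. 3, l. 13–21]. [cite: FantechiManetti1999T1Lifting, p. 3] -/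
theorem ArtinFunctor.relativeT1Lifting_of_relativeLifting (F : ArtinFunctor.{u} k) (h4 : F.H4) (Λ' : Type u)
    [CommRing Λ'] [Algebra k Λ'] (ν : ∀ X : ArtAlg.{u} k, F.obj X → (Λ' →ₐ[k] X))
    (hn : ∀ ⦃X Y : ArtAlg.{u} k⦄ (φ : X →ₐ[k] Y) (x : F.obj X), ν Y (F.map φ x) = φ.comp (ν X x))
    (hs : ∀ (R₁ R₂ : ArtAlg.{u} k) (φ : R₁ →ₐ[k] R₂), Function.Surjective φ →
      ∀ (a : F.obj R₂) (b : Λ' →ₐ[k] R₁), φ.comp b = ν R₂ a → ∃ a' : F.obj R₁, F.map φ a' = a ∧ ν R₁ a' = b)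
    (n : ℕ) (bpt : F.obj (T1Lifting.artB k n)) (apt : F.obj (T1Lifting.artA k (n + 1)))
    (hcomp : F.map (R := T1Lifting.artB k n) (S := T1Lifting.artA k n) (T1Lifting.bA k n) bpt =
      F.map (R := T1Lifting.artA k (n + 1)) (S := T1Lifting.artA k n) (T1Lifting.i k n) apt)
    (βΛ : Λ' →ₐ[k] T1Lifting.B k (n + 1)) (hβ1 : (T1Lifting.β k n).comp βΛ = ν (T1Lifting.artB k n) bpt)
    (hβ2 : (T1Lifting.bA k (n + 1)).comp βΛ = ν (T1Lifting.artA k (n + 1)) apt) :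
    ∃ b' : F.obj (T1Lifting.artB k (n + 1)),
      F.map (R := T1Lifting.artB k (n + 1)) (S := T1Lifting.artB k n) (T1Lifting.β k n) b' = bpt ∧
      F.map (R := T1Lifting.artB k (n + 1)) (S := T1Lifting.artA k (n + 1)) (T1Lifting.bA k (n + 1)) b' = apt ∧
      ν (T1Lifting.artB k (n + 1)) b' = βΛ := by
  have h4F := h4 (R₀ := T1Lifting.artA k n) (R₁ := T1Lifting.artA k (n + 1)) (R₂ := T1Lifting.artB k n)
    (R₃ := T1Lifting.artC k (n + 1)) (T1Lifting.i k n) (T1Lifting.bA k n) (T1Lifting.gC k n) (T1Lifting.jB k n)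
    (T1Lifting.isCartesian_gC_jB k n) (T1Lifting.isSmallExtension_i k n)
  have h4Λ := ArtinFunctor.points_H4 (k := k) Λ' (R₀ := T1Lifting.artA k n) (R₁ := T1Lifting.artA k (n + 1))
    (R₂ := T1Lifting.artB k n) (R₃ := T1Lifting.artC k (n + 1)) (T1Lifting.i k n) (T1Lifting.bA k n)
    (T1Lifting.gC k n) (T1Lifting.jB k n) (T1Lifting.isCartesian_gC_jB k n) (T1Lifting.isSmallExtension_i k n)
  obtain ⟨c, hcA, hcB⟩ := h4F.1 apt bpt hcomp.symm
  have hcσ : (T1Lifting.j k (n + 1)).comp βΛ = ν _ c := by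
    refine h4Λ.2 ((T1Lifting.j k (n + 1)).comp βΛ) (ν _ c) ?_ ?_
    · change (T1Lifting.gC k n).comp ((T1Lifting.j k (n + 1)).comp βΛ) = (T1Lifting.gC k n).comp (ν _ c)
      rw [← AlgHom.comp_assoc, T1Lifting.gC_comp_j, hβ2, ← hcA, hn (X := T1Lifting.artC k (n + 1))
        (Y := T1Lifting.artA k (n + 1))]
    · change (T1Lifting.jB k n).comp ((T1Lifting.j k (n + 1)).comp βΛ) = (T1Lifting.jB k n).comp (ν _ c)
      rw [← AlgHom.comp_assoc, T1Lifting.jB_comp_j, hβ1, ← hcB, hn (X := T1Lifting.artC k (n + 1))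
        (Y := T1Lifting.artB k n)]
  obtain ⟨b', hb', hb'σ⟩ := hs (T1Lifting.artB k (n + 1)) (T1Lifting.artC k (n + 1)) (T1Lifting.j k (n + 1))
    (T1Lifting.j_surjective k (n + 1)) c βΛ hcσ
  refine ⟨b', ?_, ?_, hb'σ⟩
  · have h := F.map_comp (R := T1Lifting.artB k (n + 1)) (S := T1Lifting.artC k (n + 1))
      (T := T1Lifting.artB k n) (T1Lifting.j k (n + 1)) (T1Lifting.jB k n) b'
    rw [hb', hcB] at h
    exact (congrArg (fun φ => F.map (R := T1Lifting.artB k (n + 1)) (S := T1Lifting.artB k n) φ b')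
      (T1Lifting.jB_comp_j k n)).symm.trans h
  · have h := F.map_comp (R := T1Lifting.artB k (n + 1)) (S := T1Lifting.artC k (n + 1))
      (T := T1Lifting.artA k (n + 1)) (T1Lifting.j k (n + 1)) (T1Lifting.gC k n) b'
    rw [hb', hcA] at h
    exact (congrArg (fun φ => F.map (R := T1Lifting.artB k (n + 1)) (S := T1Lifting.artA k (n + 1)) φ b')
      (T1Lifting.gC_comp_j k n)).symm.trans h

end H4Functors

/-! #### The three steps for `h_R → h_{Λ'}` (`σ : Λ' → R`; `ν = (· ∘ σ)`, (H₄) = `ArtinFunctor.points_H4 R`) -/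

/-- `relative_map_j_succ_surjective_of_relativeT1Lifting` for `h_R → h_{Λ'}`, `σ : Λ' → R` any `k`-algebra map.
[cite: FantechiManetti1999T1Lifting, p. 3] [cite: KawamataNamikawa1994LogDeformations, Thm. 3.1 (proof, p. 402)] -/
theorem relative_map_j_succ_surjective_of_relativeT1Lifting (R Λ' : Type u) [CommRing R] [Algebra k R]
    [CommRing Λ'] [Algebra k Λ'] (σ : Λ' →ₐ[k] R) (n : ℕ)
    (hT : ∀ (bpt : R →ₐ[k] T1Lifting.B k n) (apt : R →ₐ[k] T1Lifting.A k (n + 1)),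
      (T1Lifting.bA k n).comp bpt = (T1Lifting.i k n).comp apt →
      ∀ βΛ : Λ' →ₐ[k] T1Lifting.B k (n + 1), (T1Lifting.β k n).comp βΛ = bpt.comp σ →
        (T1Lifting.bA k (n + 1)).comp βΛ = apt.comp σ →
        ∃ b' : R →ₐ[k] T1Lifting.B k (n + 1), (T1Lifting.β k n).comp b' = bpt ∧
          (T1Lifting.bA k (n + 1)).comp b' = apt ∧ b'.comp σ = βΛ)
    (c : R →ₐ[k] T1Lifting.C k (n + 1)) (βΛ : Λ' →ₐ[k] T1Lifting.B k (n + 1))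
    (hc : (T1Lifting.j k (n + 1)).comp βΛ = c.comp σ) :
    ∃ b' : R →ₐ[k] T1Lifting.B k (n + 1), (T1Lifting.j k (n + 1)).comp b' = c ∧ b'.comp σ = βΛ :=
  (ArtinFunctor.points (k := k) R).relative_map_j_succ_surjective_of_relativeT1Lifting (ArtinFunctor.points_H4 R) Λ'
    (fun (X : ArtAlg.{u} k) (x : R →ₐ[k] X) => x.comp σ) (fun _ _ φ x => AlgHom.comp_assoc φ x σ) n hT c βΛ hc

/-- `relative_map_i_surjective_of_relative_map_j_surjective` for `h_R → h_{Λ'}` (`char k = 0`).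
[cite: FantechiManetti1999T1Lifting, p. 3] [cite: KawamataNamikawa1994LogDeformations, Thm. 3.1 (proof, p. 402)] -/
theorem relative_map_i_surjective_of_relative_map_j_surjective [CharZero k] (R Λ' : Type u) [CommRing R]
    [Algebra k R] [CommRing Λ'] [Algebra k Λ'] (σ : Λ' →ₐ[k] R) (m : ℕ)
    (hj : ∀ (c : R →ₐ[k] T1Lifting.C k m) (b : Λ' →ₐ[k] T1Lifting.B k m),
      (T1Lifting.j k m).comp b = c.comp σ →
      ∃ b' : R →ₐ[k] T1Lifting.B k m, (T1Lifting.j k m).comp b' = c ∧ b'.comp σ = b)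
    (a : R →ₐ[k] T1Lifting.A k m) (bA : Λ' →ₐ[k] T1Lifting.A k (m + 1))
    (hab : (T1Lifting.i k m).comp bA = a.comp σ) :
    ∃ a' : R →ₐ[k] T1Lifting.A k (m + 1), (T1Lifting.i k m).comp a' = a ∧ a'.comp σ = bA :=
  (ArtinFunctor.points (k := k) R).relative_map_i_surjective_of_relative_map_j_surjective (ArtinFunctor.points_H4 R) Λ'
    (fun (X : ArtAlg.{u} k) (x : R →ₐ[k] X) => x.comp σ) (fun _ _ φ x => AlgHom.comp_assoc φ x σ) m hj a bA hab

/-- `relativeT1Lifting_of_relativeLifting` for `h_R → h_{Λ'}`. [cite: FantechiManetti1999T1Lifting, p. 3] -/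
theorem relativeT1Lifting_of_relativeLifting (R Λ' : Type u) [CommRing R] [Algebra k R] [CommRing Λ']
    [Algebra k Λ'] (σ : Λ' →ₐ[k] R)
    (hs : ∀ (R₁ R₂ : ArtAlg.{u} k) (φ : R₁ →ₐ[k] R₂), Function.Surjective φ →
      ∀ (a : R →ₐ[k] R₂) (b : Λ' →ₐ[k] R₁), φ.comp b = a.comp σ →
        ∃ a' : R →ₐ[k] R₁, φ.comp a' = a ∧ a'.comp σ = b)
    (n : ℕ) (bpt : R →ₐ[k] T1Lifting.B k n) (apt : R →ₐ[k] T1Lifting.A k (n + 1))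
    (hcomp : (T1Lifting.bA k n).comp bpt = (T1Lifting.i k n).comp apt) (βΛ : Λ' →ₐ[k] T1Lifting.B k (n + 1))
    (hβ1 : (T1Lifting.β k n).comp βΛ = bpt.comp σ) (hβ2 : (T1Lifting.bA k (n + 1)).comp βΛ = apt.comp σ) :
    ∃ b' : R →ₐ[k] T1Lifting.B k (n + 1), (T1Lifting.β k n).comp b' = bpt ∧
      (T1Lifting.bA k (n + 1)).comp b' = apt ∧ b'.comp σ = βΛ :=
  (ArtinFunctor.points (k := k) R).relativeT1Lifting_of_relativeLifting (ArtinFunctor.points_H4 R) Λ'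
    (fun (X : ArtAlg.{u} k) (x : R →ₐ[k] X) => x.comp σ) (fun _ _ φ x => AlgHom.comp_assoc φ x σ) hs n bpt apt hcomp
    βΛ hβ1 hβ2

/-- **[KawamataNamikawa1994LogDeformations, THEOREM 3.1] FOR PRO-REPRESENTABLE FUNCTORS ON `Art_{Λ_m}`, ABSTRACT FORM**
(p. 401: «THEOREM 3.1. … Assume that `LD` is pro-representable and has the T¹-lifting property. Then `LD` is
unobstructed, i.e., its hull `R` is formally smooth over `Λ_m`.», the T¹-lifting property being
«`LD(𝒜_k[ε]) → LD(𝒜_k) ×_{LD(𝒜_{k−1})} LD(𝒜_{k−1}[ε])` surjective for all `k ≥ 0` and all `Λ_m`-algebra structures on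
the `A_k`»; p. 396: «Here the base field should be of characteristic zero.»). Typed for the functor of points of a
PRESENTED `R = P/I` over `Λ = k[[t_1, …, t_m]] ⊆ P = k[[x_1, …, x_p]]` (`t_j ↦ x_{e j}`, `I ⊆ 𝔪_Λ P + 𝔪_P²`), `char k = 0`:
if for every `n` and every `Λ`-algebra structure on `B_{n+1} = A_{n+1}[ε]` every compatible pair in
`h_R(B_n) ×_{h_R(A_n)} h_R(A_{n+1})` (structures induced) lifts to a `Λ`-map `R → B_{n+1}`, then `I = 0`: `R` IS a formal
power series ring over `Λ` («formally smooth over `Λ_m`»). PROOF = the printed two sentences: T¹-lifting ⇒ the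
liftings along every `𝒜_{N+1} → 𝒜_N`, `N ≥ 1` (`relative_map_j_succ_surjective_of_relativeT1Lifting`,
`relative_map_i_surjective_of_relative_map_j_surjective` — the step KN94 run through obstruction spaces, here through
[FantechiManetti1999T1Lifting]'s cartesian squares), «hence» formally smooth
(`powerSeries_ideal_eq_bot_of_relativeCurvilinearLifting`, the relative Lemma 5.6, `N₀ = 1`). The log deformation
functor `LD`, its pro-representability and its obstruction theory are NOT instantiated (HONEST SCOPE in the module
docstring); the hypothesis at `k = 0` of the printed definition is not used.
[cite: KawamataNamikawa1994LogDeformations, Thm. 3.1] [cite: FantechiManetti1999T1Lifting, Thm. A and p. 3] -/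
theorem powerSeries_ideal_eq_bot_of_relativeT1Lifting [CharZero k] {m p : ℕ} (e : Fin m ↪ Fin p)
    (I : Ideal (MvPowerSeries (Fin p) k))
    (hI : I ≤ Ideal.span (Set.range fun j : Fin m => (MvPowerSeries.X (e j) : MvPowerSeries (Fin p) k)) ⊔
      (IsLocalRing.maximalIdeal (MvPowerSeries (Fin p) k)) ^ 2)
    (hT : ∀ (n : ℕ) (bpt : (MvPowerSeries (Fin p) k ⧸ I) →ₐ[k] T1Lifting.B k n)
      (apt : (MvPowerSeries (Fin p) k ⧸ I) →ₐ[k] T1Lifting.A k (n + 1)),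
      (T1Lifting.bA k n).comp bpt = (T1Lifting.i k n).comp apt →
      ∀ βΛ : MvPowerSeries (Fin m) k →ₐ[k] T1Lifting.B k (n + 1),
        (T1Lifting.β k n).comp βΛ = bpt.comp ((Ideal.Quotient.mkₐ k I).comp (MvPowerSeries.rename e)) →
        (T1Lifting.bA k (n + 1)).comp βΛ = apt.comp ((Ideal.Quotient.mkₐ k I).comp (MvPowerSeries.rename e)) →
        ∃ b' : (MvPowerSeries (Fin p) k ⧸ I) →ₐ[k] T1Lifting.B k (n + 1), (T1Lifting.β k n).comp b' = bpt ∧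
          (T1Lifting.bA k (n + 1)).comp b' = apt ∧
          b'.comp ((Ideal.Quotient.mkₐ k I).comp (MvPowerSeries.rename e)) = βΛ) :
    I = ⊥ :=
  powerSeries_ideal_eq_bot_of_relativeCurvilinearLifting k e I hI 1 fun N hN a b hab => by
    obtain ⟨n, rfl⟩ : ∃ n, N = n + 1 := ⟨N - 1, by omega⟩
    exact relative_map_i_surjective_of_relative_map_j_surjective k _ _ _ (n + 1)
      (relative_map_j_succ_surjective_of_relativeT1Lifting k _ _ _ n (hT n)) a b hab

/-- **RELATIVE T¹-LIFTING ⟺ FORMALLY SMOOTH OVER `Λ`, for presented `R = P/I` over a formal power series base,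
`char k = 0`** — [KawamataNamikawa1994LogDeformations, Thm. 3.1] (⇒, `powerSeries_ideal_eq_bot_of_relativeT1Lifting`)
together with the easy converse (`relativeLifting_quotient_of_eq_bot` + `relativeT1Lifting_of_relativeLifting`),
assembled here; print states the forward direction. [cite: KawamataNamikawa1994LogDeformations, Thm. 3.1]
[cite: Schlessinger1968, Prop. 2.5 (i)] -/
theorem powerSeries_ideal_eq_bot_iff_relativeT1Lifting [CharZero k] {m p : ℕ} (e : Fin m ↪ Fin p)
    (I : Ideal (MvPowerSeries (Fin p) k))
    (hI : I ≤ Ideal.span (Set.range fun j : Fin m => (MvPowerSeries.X (e j) : MvPowerSeries (Fin p) k)) ⊔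
      (IsLocalRing.maximalIdeal (MvPowerSeries (Fin p) k)) ^ 2) :
    I = ⊥ ↔ ∀ (n : ℕ) (bpt : (MvPowerSeries (Fin p) k ⧸ I) →ₐ[k] T1Lifting.B k n)
      (apt : (MvPowerSeries (Fin p) k ⧸ I) →ₐ[k] T1Lifting.A k (n + 1)),
      (T1Lifting.bA k n).comp bpt = (T1Lifting.i k n).comp apt →
      ∀ βΛ : MvPowerSeries (Fin m) k →ₐ[k] T1Lifting.B k (n + 1),
        (T1Lifting.β k n).comp βΛ = bpt.comp ((Ideal.Quotient.mkₐ k I).comp (MvPowerSeries.rename e)) →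
        (T1Lifting.bA k (n + 1)).comp βΛ = apt.comp ((Ideal.Quotient.mkₐ k I).comp (MvPowerSeries.rename e)) →
        ∃ b' : (MvPowerSeries (Fin p) k ⧸ I) →ₐ[k] T1Lifting.B k (n + 1), (T1Lifting.β k n).comp b' = bpt ∧
          (T1Lifting.bA k (n + 1)).comp b' = apt ∧
          b'.comp ((Ideal.Quotient.mkₐ k I).comp (MvPowerSeries.rename e)) = βΛ := by
  constructor
  · intro h0 n bpt apt hcomp βΛ hβ1 hβ2
    exact relativeT1Lifting_of_relativeLifting k _ _ _
      (fun R₁ R₂ φ hφ a b hab => relativeLifting_quotient_of_eq_bot k e I h0 φ hφ a b hab)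
      n bpt apt hcomp βΛ hβ1 hβ2
  · exact powerSeries_ideal_eq_bot_of_relativeT1Lifting k e I hI

/-! ### [Schlessinger1968, Remark 2.10] over `Λ`: for a functor WITH A GIVEN HULL `h_R → F` over `h_Λ`, «`R` is a power
series ring over `Λ` if and only if `F → h_Λ` is smooth» -/

/-- [Schlessinger1968, (2.4), p. 211] in relative dress, the step used by Remark 2.10: a morphism `ν : h_R → F` that is
smooth (lifts along every surjection of `Art_k`) and onto on `A_0`-points (`A_0 = k`; print's `F(k) = {pt}`) is onto on
`X`-points for every `X ∈ Art_k` (every `X` surjects onto `A_0`). [cite: Schlessinger1968, (2.4) and Remark 2.10] -/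
theorem points_surjective_of_smooth_of_surjective_zero (R : Type u) [CommRing R] [Algebra k R] (F : ArtinFunctor.{u} k)
    (ν : ∀ X : ArtAlg.{u} k, (R →ₐ[k] X) → F.obj X)
    (hν : ∀ ⦃B A : ArtAlg.{u} k⦄ (p : B →ₐ[k] A), Function.Surjective p →
      ∀ (y : R →ₐ[k] A) (z : F.obj B), ν A y = F.map p z → ∃ x : R →ₐ[k] B, p.comp x = y ∧ ν B x = z)
    (h0 : Function.Surjective (ν (T1Lifting.artA k 0))) (X : ArtAlg.{u} k) : Function.Surjective (ν X) := by
  intro z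
  obtain ⟨aug⟩ := X.exists_augmentation
  -- the surjection `X → A_0 = k`
  set q : X →ₐ[k] T1Lifting.artA k 0 := (Algebra.ofId k (T1Lifting.A k 0)).comp aug with hq
  have hqs : Function.Surjective q := by
    intro c
    obtain ⟨c', b, hb⟩ := T1Lifting.exists_eq_algebraMap_add_t_mul k 0 c
    refine ⟨algebraMap k X c', ?_⟩
    rw [hq, AlgHom.commutes, hb, T1Lifting.t_zero_eq_zero, zero_mul, add_zero]
  obtain ⟨y₀, hy₀⟩ := h0 (F.map (R := X) (S := T1Lifting.artA k 0) q z)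
  obtain ⟨x, -, hx⟩ := hν q hqs y₀ z hy₀
  exact ⟨x, hx⟩

/-- **[Schlessinger1968, REMARK 2.10] OVER `Λ = k[[t_1, …, t_m]]`, for a PRESENTED hull** (Trans. AMS 130, p. 212:
«Let `(R, ξ)` be a hull of `F`. Then `R` is a power series ring over `Λ` if and only if `F` transforms surjections
`B → A` in `C` [= `C_Λ`] into surjections `F(B) → F(A)`. In fact the stated condition on `F` is equivalent to the
smoothness of the natural morphism `F → h_Λ`. … we conclude that `h_R → h_Λ` is smooth if and only if `F → h_Λ` is. Now
use 2.5 (i).»; the tree's `ArtinFunctor.hull_ideal_eq_bot_iff_smooth` is the case `Λ = k`). Here: `F` a functor of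
Artin rings over `h_Λ` (`θ : F → h_Λ` natural — a functor on `Art_Λ` read on `Art_k`), a HULL in the printed definiens of
[FantechiManetti1999T1Lifting, p. 6 L3] («a smooth morphism `h_R → F`») with `R = P/I` PRESENTED over `Λ`
(`I ⊆ 𝔪_Λ P + 𝔪_P²`): `ν : h_R → F` natural, compatible with the `Λ`-structures (`θ ∘ ν = (· ∘ σ)`,
`σ : Λ → P → R`; the naturality of `θ` itself is not used), smooth (lifts along every surjection of `Art_k`), onto on
`A_0`-points. THEN `I = 0` («`R` is a power
series ring over `Λ`») IFF `F → h_Λ` is smooth (every `a ∈ F(A)` with a compatible `Λ`-structure `b` on `B ↠ A` lifts to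
`F(B)` with `Λ`-structure `b`). ⇒: `h_R → h_Λ` smooth (`relativeLifting_quotient_of_eq_bot`), `ν` onto on points
((2.4), `points_surjective_of_smooth_of_surjective_zero`), then Prop. 2.5 (iii) by hand; ⇐: Prop. 2.5 (ii) by hand
(compose the two liftings), then `powerSeries_ideal_eq_bot_iff_relativelySmooth` (2.5 (i) at `R = Λ`).
[cite: Schlessinger1968, Remark 2.10] [cite: KawamataNamikawa1994LogDeformations, Thm. 3.1] -/
theorem hull_ideal_eq_bot_iff_relativelySmooth {m p : ℕ} (e : Fin m ↪ Fin p) (I : Ideal (MvPowerSeries (Fin p) k))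
    (hI : I ≤ Ideal.span (Set.range fun j : Fin m => (MvPowerSeries.X (e j) : MvPowerSeries (Fin p) k)) ⊔
      (IsLocalRing.maximalIdeal (MvPowerSeries (Fin p) k)) ^ 2)
    (F : ArtinFunctor.{u} k) (θ : ∀ X : ArtAlg.{u} k, F.obj X → (MvPowerSeries (Fin m) k →ₐ[k] X))
    (ν : ∀ X : ArtAlg.{u} k, ((MvPowerSeries (Fin p) k ⧸ I) →ₐ[k] X) → F.obj X)
    (hn : ∀ ⦃X Y : ArtAlg.{u} k⦄ (φ : X →ₐ[k] Y) (x : (MvPowerSeries (Fin p) k ⧸ I) →ₐ[k] X),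
      ν Y (φ.comp x) = F.map φ (ν X x))
    (hcompat : ∀ (X : ArtAlg.{u} k) (x : (MvPowerSeries (Fin p) k ⧸ I) →ₐ[k] X),
      θ X (ν X x) = x.comp ((Ideal.Quotient.mkₐ k I).comp (MvPowerSeries.rename e)))
    (hν : ∀ ⦃B A : ArtAlg.{u} k⦄ (q : B →ₐ[k] A), Function.Surjective q →
      ∀ (y : (MvPowerSeries (Fin p) k ⧸ I) →ₐ[k] A) (z : F.obj B), ν A y = F.map q z →
        ∃ x : (MvPowerSeries (Fin p) k ⧸ I) →ₐ[k] B, q.comp x = y ∧ ν B x = z)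
    (h0 : Function.Surjective (ν (T1Lifting.artA k 0))) :
    I = ⊥ ↔ ∀ (R₁ R₂ : ArtAlg.{u} k) (φ : R₁ →ₐ[k] R₂), Function.Surjective φ →
      ∀ (a : F.obj R₂) (b : MvPowerSeries (Fin m) k →ₐ[k] R₁), φ.comp b = θ R₂ a →
        ∃ a' : F.obj R₁, F.map φ a' = a ∧ θ R₁ a' = b := by
  constructor
  · intro hI0 R₁ R₂ φ hφ a b hab
    -- `ν` is onto on points ((2.4)), so `a = ν y`; lift `y` in `h_R → h_Λ` (smooth since `I = 0`), push by `ν`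
    obtain ⟨y, rfl⟩ :=
      points_surjective_of_smooth_of_surjective_zero k (MvPowerSeries (Fin p) k ⧸ I) F ν hν h0 R₂ a
    obtain ⟨x, hx, hxσ⟩ := relativeLifting_quotient_of_eq_bot k e I hI0 φ hφ y b (by rw [hab, hcompat])
    refine ⟨ν R₁ x, ?_, ?_⟩
    · rw [← hn, hx]
    · rw [hcompat, hxσ]
  · intro hs
    refine (powerSeries_ideal_eq_bot_iff_relativelySmooth k e I hI).2 fun R₁ R₂ φ hφ y b hyb => ?_
    -- lift `ν y` in `F → h_Λ`, then lift `y` in `h_R → F` over that element (Prop. 2.5 (ii) by hand)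
    obtain ⟨a', ha', ha'b⟩ := hs R₁ R₂ φ hφ (ν R₂ y) b (by rw [hcompat, hyb])
    obtain ⟨x, hx, hxa⟩ := hν φ hφ y a' ha'.symm
    refine ⟨x, hx, ?_⟩
    rw [← hcompat, hxa, ha'b]

/-! ### [KawamataNamikawa1994LogDeformations]'s OWN route for the first step, absolute form: «By the T¹-lifting
property, we have `δ₂ = 0`. Since `α″` is an isomorphism, we also have `δ₁ = 0`» — through an OBSTRUCTION SPACE
([FantechiManetti1999T1Lifting, Def. 0.1], the tree's `ArtinFunctor.ObstructionSpace`) instead of (H₁)/(H₄) -/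

/-- `α″` is injective, on elements: an element of `ker(A_{m+1} → A_m) = k · t^{m+1}` killed by
`α = fB : t ↦ x + y` is zero, because `fB(t^{m+1}) = (x + y)^{m+1} = (m+1) x^m y ≠ 0` in characteristic zero
(`T1Lifting.xy_pow_succ`, `T1Lifting.xny_ne_zero`). [cite: KawamataNamikawa1994LogDeformations, Thm. 3.1 (proof, p. 402)]
[cite: FantechiManetti1999T1Lifting, p. 3] -/
theorem T1Lifting.eq_zero_of_i_eq_zero_of_fB_eq_zero [CharZero k] (m : ℕ) {e : T1Lifting.A k (m + 1)}
    (hi : T1Lifting.i k m e = 0) (hf : T1Lifting.fB k m e = 0) : e = 0 := by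
  obtain ⟨c, rfl⟩ := T1Lifting.exists_eq_smul_of_i_eq_zero k m hi
  rw [map_smul, map_pow, T1Lifting.fB_t, T1Lifting.xy_pow_succ, smul_smul, smul_eq_zero] at hf
  rcases hf with h | h
  · rcases mul_eq_zero.1 h with h' | h'
    · rw [h', zero_smul]
    · exact absurd h' (Nat.cast_ne_zero.2 (Nat.succ_ne_zero m))
  · exact absurd h (T1Lifting.xny_ne_zero k m)

/-- The morphism of small extensions `(i : A_{m+1} → A_m) → (j : B_m → C_m)` given by `α = fB : t ↦ x + y` and
`α′ = fC : t ↦ x + y` ([KawamataNamikawa1994LogDeformations, proof of Thm. 3.1, p. 401]: «We define homomorphisms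
`α : A_{k+1} → A_k[ε]` and `α′ : A_k → C_k` by setting `α(t) = α′(t) = t + ε`»; [FantechiManetti1999T1Lifting, p. 3]:
`f(t) = x + y`) induces on kernels `α″ : t^{m+1} ↦ (x + y)^{m+1} = (m+1) x^m y`, which is INJECTIVE in characteristic
zero («Since `α″` is an isomorphism», p. 402) — stated for the kernel map `kerMap` of the tree's obstruction-space
formalism (carriers of the `ArtAlg` objects `artA`, `artB`, `artC`).
[cite: KawamataNamikawa1994LogDeformations, Thm. 3.1 (proof, pp. 401–402)] -/
theorem T1Lifting.kerMap_fB_injective [CharZero k] (m : ℕ) :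
    Function.Injective (kerMap (k := k) (R₁ := ↥(T1Lifting.artA k (m + 1))) (R₀ := ↥(T1Lifting.artA k m))
      (R₁' := ↥(T1Lifting.artB k m)) (R₀' := ↥(T1Lifting.artC k m)) (p := T1Lifting.i k m) (p' := T1Lifting.j k m)
      (T1Lifting.fB k m) (ᾱ := T1Lifting.fC k m) (T1Lifting.j_comp_fB k m)) := by
  refine (injective_iff_map_eq_zero _).2 fun x hx => ?_
  have hi : T1Lifting.i k m (x : T1Lifting.A k (m + 1)) = 0 :=
    (RingHom.mem_ker).1 ((Submodule.restrictScalars_mem k _ _).1 x.2)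
  have hf : T1Lifting.fB k m (x : T1Lifting.A k (m + 1)) = 0 := congrArg Subtype.val hx
  exact Subtype.ext (T1Lifting.eq_zero_of_i_eq_zero_of_fB_eq_zero k m hi hf)

/-- **«`δ₂ = 0` ⇒ `δ₁ = 0`» ([KawamataNamikawa1994LogDeformations, proof of Thm. 3.1, p. 402], absolute form; for a
pro-representable `D` with an obstruction space this is also C. Lehn, Dissertation Mainz 2011, Lemma VI.3.7, as the
docstring of the tree's `ArtinFunctor.map_i_surjective_of_map_j_surjective` records):** let `F` be a functor of Artin
rings with an OBSTRUCTION SPACE `(T², ob)` ([FantechiManetti1999T1Lifting, Def. 0.1]: complete and functorial in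
morphisms of small extensions — [KawamataNamikawa1994LogDeformations, Thm. 2.2 (3)] for `LD`), `char k = 0`. If
`F(B_m) → F(C_m)` is onto (the T¹-lifting property at level `m` in its `C`-form ∕ fibre-product form for
pro-representable functors), then `F(A_{m+1}) → F(A_m)` is onto: for `a ∈ F(A_m)`, functoriality along `(α, α′)` gives
`ob_j(F(α′) a) = (α″ ⊗ 1)(ob_i(a))`; the left side vanishes because `F(α′) a` lifts to `F(B_m)` («`δ₂ = 0`»), `α″ ⊗ 1`
is injective (`T1Lifting.kerMap_fB_injective`; `T²` is flat over the field `k`), so `ob_i(a) = 0` («`δ₁ = 0`») and `a`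
lifts. Compared with the tree's routes — `ArtinFunctor.map_i_surjective_of_map_j_surjective` ((H₁), cartesian square
`A_{m+1} = B_m ×_{C_m} A_m`) and `ArtinFunctor.t1Lifting_theorem` ((H₁), (H₂), `T²`, Def. 1.1 form) — this one assumes
the obstruction space and NOTHING of (H₁)/(H₂)/(H₄). [cite: KawamataNamikawa1994LogDeformations, Thm. 3.1 (proof, p. 402)]
[cite: FantechiManetti1999T1Lifting, Def. 0.1 and p. 3] -/
theorem ArtinFunctor.map_i_surjective_of_map_j_surjective_of_obstructionSpace [CharZero k] (F : ArtinFunctor.{u} k)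
    {T2 : Type u} [AddCommGroup T2] [Module k T2] (O : F.ObstructionSpace T2) (m : ℕ)
    (hj : Function.Surjective (F.map (R := T1Lifting.artB k m) (S := T1Lifting.artC k m) (T1Lifting.j k m))) :
    Function.Surjective (F.map (R := T1Lifting.artA k (m + 1)) (S := T1Lifting.artA k m) (T1Lifting.i k m)) := by
  intro a
  have hfunc := O.functorial (R₁ := T1Lifting.artA k (m + 1)) (R₀ := T1Lifting.artA k m) (R₁' := T1Lifting.artB k m)
    (R₀' := T1Lifting.artC k m) (T1Lifting.i k m) (T1Lifting.isSmallExtension_i k m).isSmallExt (T1Lifting.j k m)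
    (T1Lifting.isSmallExtension_j k m).isSmallExt (T1Lifting.fB k m) (T1Lifting.fC k m) (T1Lifting.j_comp_fB k m) a
  -- «`δ₂ = 0`»
  have h2 : O.ob (R₁ := T1Lifting.artB k m) (R₀ := T1Lifting.artC k m) (T1Lifting.j k m)
      (T1Lifting.isSmallExtension_j k m).isSmallExt
      (F.map (R := T1Lifting.artA k m) (S := T1Lifting.artC k m) (T1Lifting.fC k m) a) = 0 :=
    (O.exact (R₁ := T1Lifting.artB k m) (R₀ := T1Lifting.artC k m) (T1Lifting.j k m)
      (T1Lifting.isSmallExtension_j k m).isSmallExt _).1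
      (hj (F.map (R := T1Lifting.artA k m) (S := T1Lifting.artC k m) (T1Lifting.fC k m) a))
  -- «Since `α″` is an isomorphism, we also have `δ₁ = 0`» (`T²` is flat over the field `k`)
  have hinj := Module.Flat.lTensor_preserves_injective_linearMap (M := T2) _ (T1Lifting.kerMap_fB_injective k m)
  have h1 : O.ob (R₁ := T1Lifting.artA k (m + 1)) (R₀ := T1Lifting.artA k m) (T1Lifting.i k m)
      (T1Lifting.isSmallExtension_i k m).isSmallExt a = 0 := by
    apply hinj
    rw [map_zero]
    exact hfunc.symm.trans h2
  exact (O.exact (R₁ := T1Lifting.artA k (m + 1)) (R₀ := T1Lifting.artA k m) (T1Lifting.i k m)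
    (T1Lifting.isSmallExtension_i k m).isSmallExt a).2 h1

/-- **The T¹-lifting principle through an obstruction space, all levels** ([KawamataNamikawa1994LogDeformations,
proof of Thm. 3.1] run for every `k ≥ 0`; [FantechiManetti1999T1Lifting, p. 3, l. 3–4]: «it is sufficient to prove
that for every integer `m ≥ 1` `F(A_{m+1}) → F(A_m)` is surjective»): a functor of Artin rings with an obstruction
space over a field of characteristic zero for which every `F(B_n) → F(C_n)` is onto (`ArtinFunctor.T1LiftingH4`, the
(H₄)-∕`C`-form of the T¹-lifting property) has every `F(A_{m+1}) → F(A_m)` onto. For pro-representable `F = h_R`,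
`R = k[[x]]/I`, `I ⊆ 𝔪²`, [FantechiManetti1998ObstructionCalculus, Lemma 5.6] then gives `I = 0` (tree:
`powerSeries_ideal_eq_bot_of_points_map_i_surjective`). [cite: KawamataNamikawa1994LogDeformations, Thm. 3.1 (proof, p. 402)]
[cite: FantechiManetti1999T1Lifting, p. 3] -/
theorem ArtinFunctor.map_i_surjective_of_t1LiftingH4_of_obstructionSpace [CharZero k] (F : ArtinFunctor.{u} k)
    {T2 : Type u} [AddCommGroup T2] [Module k T2] (O : F.ObstructionSpace T2) (hT : F.T1LiftingH4) (m : ℕ) :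
    Function.Surjective (F.map (R := T1Lifting.artA k (m + 1)) (S := T1Lifting.artA k m) (T1Lifting.i k m)) :=
  F.map_i_surjective_of_map_j_surjective_of_obstructionSpace k O m (hT m)

end RelativePowerSeries

end Literature.AlgebraicGeometry.Deformation
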